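import Literature.NumberTheory.Sieve.BombieriAsymptoticSieveProofs
import Literature.NumberTheory.Sieve.BombieriAsymptoticSieveSigma0
import Literature.NumberTheory.Sieve.BombieriAsymptoticSieveVectorLambda
import HarnessLib

/-!
# Bombieri's asymptotic sieve, vector weights: the sieve lemmata for a general coefficient

Topic `Literature/NumberTheory/Sieve`, companion ("Proofs") file of
`BombieriAsymptoticSieveVector.lean`. Source: J. Friedlander, H. Iwaniec, *On Bombieri's asymptotic
sieve*, Ann. Scuola Norm. Sup. Pisa Cl. Sci. (4) **5** (1978) 719–756 [FriedlanderIwaniecPisa1978],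
§4 (pp. 735–740), Lemmata 11 and 12 and the dissection of p. 735, for a GENERAL VECTOR
`(k) = (k', a)`: there `Λ_(k)(n) = ∑_{d ∣ n} 𝔏_(k')(d) (log n/d)^a` with `𝔏_(k') = Λ_(k') ∗ μ`
(Remark, p. 735), and the proofs of Lemmata 11–12 use about `𝔏` only the bound
`|𝔏(d)| ≤ (log x)^{|k'|}` (p. 738).

Accordingly this file re-runs the tree's proofs of the scalar case (`𝔏 = μ`, `|μ| ≤ 1`;
`BombieriAsymptoticSieveLemma11.lean`, `BombieriAsymptoticSieveLemma12.lean`) for an ARBITRARY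
coefficient sequence `lam : ℕ → ℝ` subject to `|lam d| ≤ M` on `1 ≤ d ≤ x`, the bound `M ≥ 0`
entering the conclusions linearly:

* `abs_truncUpperGen_le`, `abs_sigma2Gen_le`, `lemma11Gen` — Lemma 11:
  `|Σ₂(lam, a)| ≤ C · M · A(x)(log x/y)^{a+1}(log z)^{−2}`;
* `sigma1Gen_eq_sum_mul`, `lemma12Gen` — Lemma 12:
  `|Σ₁(lam, a) − H A(x) F(lam, a)| ≤ C · M · (e^{−s} A L^{a−1} + (∫₁^x A(t)dt/t) L^{a−2} +
  z^{−η} A L^a)(L/log z)²`, `F(lam, a) = ∏_{p<z}(1 − 1/p) ∑_{d<y,(d,P(z))=1} lam(d) d⁻¹ (log x/d)^a`;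
* `sum_eq_sigma0Gen_add` — the dissection `∑ a_n (lam ∗ log^a)(n) = Σ₀ + Σ₁ + Σ₂`.

All sums are written out explicitly (no auxiliary definitions); the constants `C` depend on the
sequence and on `a` only, the thresholds in `x` on `ε` (and `s`), exactly as in the scalar files,
whose proofs are followed line by line. The fundamental lemma enters through the tree's theorem
`SieveSequence.fundamental_lemma_uniform_holds`.
-/

noncomputable section

open Filter Finset
open scoped Topology

namespace Literature.NumberTheory.Sieve

namespace BombieriSieve

open scoped ArithmeticFunction.Moebius
open MeasureTheory

/-! ### Lemma 11 for a general coefficient -/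

/-- For `n ≤ x`, `0 < y ≤ x` and `|lam d| ≤ M` (`1 ≤ d ≤ x`):
`|∑_{de = n, d ≥ y} lam(d)(log e)^a| ≤ M (log x/y)^a · #{m ∣ n : m ≤ x/y}` (the first display in
the proof of [FriedlanderIwaniecPisa1978] Lemma 11: `e = n/d ≤ x/y` and `d ↦ e` is injective).
[cite: FriedlanderIwaniecPisa1978, Lemma 11 (proof)] -/
theorem abs_truncUpperGen_le {lam : ℕ → ℝ} {M : ℝ} (hM : 0 ≤ M) (a : ℕ) {x y : ℝ} (hy : 0 < y)
    (hyx : y ≤ x) {n : ℕ} (hnx : (n : ℝ) ≤ x)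
    (hlam : ∀ d : ℕ, 1 ≤ d → (d : ℝ) ≤ x → |lam d| ≤ M) :
    |∑ e ∈ n.divisorsAntidiagonal with y ≤ ((e.1 : ℕ) : ℝ), lam e.1 * Real.log e.2 ^ a| ≤
      M * Real.log (x / y) ^ a * #(n.divisors.filter (fun m : ℕ => (m : ℝ) ≤ x / y)) := by
  have hlog0 : 0 ≤ Real.log (x / y) := Real.log_nonneg ((one_le_div hy).mpr hyx)
  set T := n.divisorsAntidiagonal.filter (fun e : ℕ × ℕ => y ≤ ((e.1 : ℕ) : ℝ)) with hT
  -- for `(d, m) ∈ T`: `m ∣ n`, `1 ≤ m ≤ x / y`, `1 ≤ d ≤ x`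
  have hmem : ∀ e ∈ T, (e.2 ∈ n.divisors.filter (fun m : ℕ => (m : ℝ) ≤ x / y) ∧ 1 ≤ e.2) ∧
      1 ≤ e.1 ∧ (e.1 : ℝ) ≤ x := by
    intro e he
    obtain ⟨he', hye⟩ := Finset.mem_filter.mp he
    obtain ⟨hprod, hn⟩ := Nat.mem_divisorsAntidiagonal.mp he'
    have he2 : e.2 ≠ 0 := fun h => hn (by rw [← hprod, h, mul_zero])
    have he1 : e.1 ≠ 0 := fun h => hn (by rw [← hprod, h, zero_mul])
    have he1pos : (0 : ℝ) < e.1 := by exact_mod_cast Nat.pos_of_ne_zero he1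
    have hx0 : 0 ≤ x := hy.le.trans hyx
    refine ⟨⟨Finset.mem_filter.mpr ⟨Nat.mem_divisors.mpr ⟨⟨e.1, by rw [mul_comm, hprod]⟩, hn⟩, ?_⟩,
      Nat.one_le_iff_ne_zero.mpr he2⟩, Nat.one_le_iff_ne_zero.mpr he1, ?_⟩
    · have h2 : (e.2 : ℝ) = n / e.1 := by
        rw [eq_div_iff he1pos.ne', ← Nat.cast_mul, mul_comm, hprod]
      rw [h2, div_le_div_iff₀ he1pos hy]
      calc (n : ℝ) * y ≤ x * y := mul_le_mul_of_nonneg_right hnx hy.le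
        _ ≤ x * e.1 := mul_le_mul_of_nonneg_left hye hx0
    · have h1 : e.1 ≤ n := by
        rw [← hprod]
        exact Nat.le_mul_of_pos_right _ (Nat.pos_of_ne_zero he2)
      exact le_trans (by exact_mod_cast h1) hnx
  -- termwise bound
  have hbound : ∀ e ∈ T, |lam e.1 * Real.log e.2 ^ a| ≤ M * Real.log (x / y) ^ a := by
    intro e he
    obtain ⟨⟨hm, h1⟩, hd1, hdx⟩ := hmem e he
    have hmx : (e.2 : ℝ) ≤ x / y := (Finset.mem_filter.mp hm).2
    have hl0 : 0 ≤ Real.log e.2 := Real.log_natCast_nonneg _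
    have hl : Real.log e.2 ≤ Real.log (x / y) := Real.log_le_log (by exact_mod_cast h1) hmx
    rw [abs_mul, abs_of_nonneg (pow_nonneg hl0 _)]
    exact mul_le_mul (hlam e.1 hd1 hdx) (pow_le_pow_left₀ hl0 hl _) (pow_nonneg hl0 _) hM
  -- counting: `(d, m) ↦ m` is injective on `T`
  have hcard : #T ≤ #(n.divisors.filter (fun m : ℕ => (m : ℝ) ≤ x / y)) := by
    refine Finset.card_le_card_of_injOn Prod.snd (fun e he => (hmem e he).1.1) ?_
    intro e he e' he' h
    obtain ⟨hprod, hn⟩ := Nat.mem_divisorsAntidiagonal.mp (Finset.mem_filter.mp he).1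
    obtain ⟨hprod', -⟩ := Nat.mem_divisorsAntidiagonal.mp (Finset.mem_filter.mp he').1
    have h2 : e.2 ≠ 0 := fun h0 => hn (by rw [← hprod, h0, mul_zero])
    change e.2 = e'.2 at h
    have h1 : e.1 = e'.1 := by
      apply Nat.eq_of_mul_eq_mul_right (Nat.pos_of_ne_zero h2)
      rw [hprod, h, hprod']
    exact Prod.ext h1 h
  refine (Finset.abs_sum_le_sum_abs _ _).trans ?_
  refine (Finset.sum_le_sum hbound).trans ?_
  rw [Finset.sum_const, nsmul_eq_mul, mul_comm]
  exact mul_le_mul_of_nonneg_left (by exact_mod_cast hcard) (mul_nonneg hM (pow_nonneg hlog0 _))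

/-- **`Σ₂(lam, a)` against the sifted subsequences** (proof of [FriedlanderIwaniecPisa1978]
Lemma 11, first step, general coefficient): for `0 < y ≤ x` and `|lam d| ≤ M` on `[1, x]`,
`|Σ₂| ≤ M (log x/y)^a ∑_{m ≤ x/y, (m, P(z)) = 1} S(𝒜_m, z; x)`. [cite: FriedlanderIwaniecPisa1978, Lemma 11 (proof)] -/
theorem abs_sigma2Gen_le (A : SieveSequence) {lam : ℕ → ℝ} {M : ℝ} (hM : 0 ≤ M) (a : ℕ)
    {x y : ℝ} (z : ℝ) (hy : 0 < y) (hyx : y ≤ x)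
    (hlam : ∀ d : ℕ, 1 ≤ d → (d : ℝ) ≤ x → |lam d| ≤ M) :
    |∑ n ∈ (Ioc 0 ⌊x⌋₊).filter (fun n : ℕ => n.Coprime (primesProdBelow z)),
        (∑ e ∈ n.divisorsAntidiagonal with y ≤ ((e.1 : ℕ) : ℝ), lam e.1 * Real.log e.2 ^ a) *
          A.a n| ≤
      M * Real.log (x / y) ^ a *
        ∑ m ∈ (Ioc 0 ⌊x / y⌋₊).filter (fun m : ℕ => m.Coprime (primesProdBelow z)),
          (A.restrictDvd m).sifted x (primesProdBelow z) := by
  have hx0 : 0 ≤ x := hy.le.trans hyx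
  have hxy0 : 0 ≤ x / y := div_nonneg hx0 hy.le
  have hlog0 : 0 ≤ Real.log (x / y) := Real.log_nonneg ((one_le_div hy).mpr hyx)
  have hK0 : 0 ≤ M * Real.log (x / y) ^ a := mul_nonneg hM (pow_nonneg hlog0 _)
  set P := primesProdBelow z with hP
  set N := ⌊x⌋₊ with hN
  set D := ⌊x / y⌋₊ with hD
  -- the weight `1_{(n,P)=1} a_n`
  set a' : ℕ → ℝ := fun n => if n.Coprime P then A.a n else 0 with ha'
  -- Step 1: termwise
  have hstep1 : |∑ n ∈ (Ioc 0 N).filter (fun n : ℕ => n.Coprime P),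
      (∑ e ∈ n.divisorsAntidiagonal with y ≤ ((e.1 : ℕ) : ℝ), lam e.1 * Real.log e.2 ^ a) *
        A.a n| ≤ M * Real.log (x / y) ^ a *
      ∑ n ∈ Ioc 0 N, a' n * ∑ m ∈ n.divisors with m ≤ D, (1 : ℝ) := by
    rw [Finset.mul_sum]
    refine (Finset.abs_sum_le_sum_abs _ _).trans ?_
    rw [← Finset.sum_filter_add_sum_filter_not (Ioc 0 N) (fun n : ℕ => n.Coprime P)
      (fun n => M * Real.log (x / y) ^ a * (a' n * ∑ m ∈ n.divisors with m ≤ D, (1 : ℝ)))]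
    have hzero : ∑ n ∈ (Ioc 0 N).filter (fun n : ℕ => ¬ n.Coprime P),
        M * Real.log (x / y) ^ a * (a' n * ∑ m ∈ n.divisors with m ≤ D, (1 : ℝ)) = 0 := by
      refine Finset.sum_eq_zero fun n hn => ?_
      rw [ha']
      simp only
      rw [if_neg (Finset.mem_filter.mp hn).2, zero_mul, mul_zero]
    rw [hzero, add_zero]
    refine Finset.sum_le_sum fun n hn => ?_
    obtain ⟨hn', hcop⟩ := Finset.mem_filter.mp hn
    have hnx : (n : ℝ) ≤ x := le_trans (by exact_mod_cast (Finset.mem_Ioc.mp hn').2) (Nat.floor_le hx0)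
    rw [abs_mul, abs_of_nonneg (A.a_nonneg n), ha']
    simp only
    rw [if_pos hcop]
    have hcard : ((#(n.divisors.filter (fun m : ℕ => (m : ℝ) ≤ x / y)) : ℕ) : ℝ) =
        ∑ m ∈ n.divisors with m ≤ D, (1 : ℝ) := by
      rw [Finset.sum_const, nsmul_eq_mul, mul_one]
      congr 2
      ext m
      simp only [Finset.mem_filter, hD]
      exact and_congr_right fun _ => (Nat.le_floor_iff hxy0).symm
    calc |∑ e ∈ n.divisorsAntidiagonal with y ≤ ((e.1 : ℕ) : ℝ), lam e.1 * Real.log e.2 ^ a| * A.a n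
        ≤ (M * Real.log (x / y) ^ a * #(n.divisors.filter (fun m : ℕ => (m : ℝ) ≤ x / y))) *
            A.a n :=
          mul_le_mul_of_nonneg_right (abs_truncUpperGen_le hM a hy hyx hnx hlam) (A.a_nonneg n)
      _ = M * Real.log (x / y) ^ a * (A.a n * ∑ m ∈ n.divisors with m ≤ D, (1 : ℝ)) := by
          rw [← hcard]
          ring
  refine hstep1.trans (mul_le_mul_of_nonneg_left (le_of_eq ?_) hK0)
  -- Step 2: interchange
  rw [sum_mul_sum_divisors_le_eq a' (fun _ => (1 : ℝ)) N D]
  simp only [one_mul]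
  -- Step 3: inner sums are the sifted subsequence sums; outer sum restricts to `(m, P) = 1`
  have hinner : ∀ m : ℕ, ∑ n ∈ (Ioc 0 N).filter (m ∣ ·), a' n = (A.restrictDvd m).sifted x P := by
    intro m
    rw [sifted_restrictDvd, ← hN, ha', Finset.sum_filter, Finset.sum_filter]
    refine Finset.sum_congr rfl fun n _ => ?_
    by_cases hmn : m ∣ n
    · by_cases hc : n.Coprime P
      · rw [if_pos hmn, if_pos hc, if_pos ⟨hc, hmn⟩]
      · rw [if_pos hmn, if_neg hc, if_neg (fun h => hc h.1)]
    · rw [if_neg hmn, if_neg (fun h => hmn h.2)]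
  simp_rw [hinner]
  symm
  refine Finset.sum_subset (Finset.filter_subset _ _) fun m hm hmnot => ?_
  have hmc : ¬ m.Coprime P := fun h => hmnot (Finset.mem_filter.mpr ⟨hm, h⟩)
  rw [sifted_restrictDvd]
  refine Finset.sum_eq_zero fun n hn => ?_
  obtain ⟨-, hc, hmn⟩ := Finset.mem_filter.mp hn
  exact absurd (Nat.Coprime.coprime_dvd_left hmn hc) hmc

/-- **[FriedlanderIwaniecPisa1978] Lemma 11 for a general coefficient.** For a Bombieri sequence
`𝒜` and an exponent `a`, there is `C` such that for every `ε > 0`, all large `x`, all `y, z` with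
`2 ≤ z`, `zy < x`, `z√x < y < x^{1−ε}`, and every coefficient sequence with `|lam d| ≤ M` on
`1 ≤ d ≤ x` (`M ≥ 0`):
`|Σ₂(lam, a)| ≤ C · M · A(x)(log x/y)^{a+1}(log z)^{−2}`,
`Σ₂(lam, a) = ∑_{n ≤ x,(n,P(z))=1} a_n ∑_{de = n, d ≥ y} lam(d)(log e)^a`. This is the printed
Lemma 11 (`Σ₂ ≪ A(x)(log x/y)^{a+1}(log x)^{|k'|}(log z)^{−2}`) once `M = (log x)^{|k'|}` bounds
`|𝔏_(k')|`; the proof is that of the scalar case (`FI1978_lemma11_of_fundamentalLemma`: the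
fundamental lemma at level `z²` for each `𝒜_m`, (A₂) for the distinct moduli `νm ≤ z²x/y`,
Lemmata 7 and 8), with `abs_sigma2Gen_le` as the first step; `C = (1 + C_FL) C₇ C₈ + 1`.
[cite: FriedlanderIwaniecPisa1978, Lemma 11] -/
theorem lemma11Gen (A : SieveSequence) (hA : A.IsBombieriSequence) (a : ℕ) :
    ∃ C : ℝ, ∀ ε : ℝ, 0 < ε → ∀ᶠ x : ℝ in atTop, ∀ (y z M : ℝ) (lam : ℕ → ℝ), 0 ≤ M →
      (∀ d : ℕ, 1 ≤ d → (d : ℝ) ≤ x → |lam d| ≤ M) → 2 ≤ z → z * y < x →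
      z * Real.sqrt x < y → y < x ^ (1 - ε) →
        |∑ n ∈ (Ioc 0 ⌊x⌋₊).filter (fun n : ℕ => n.Coprime (primesProdBelow z)),
            (∑ e ∈ n.divisorsAntidiagonal with y ≤ ((e.1 : ℕ) : ℝ),
              lam e.1 * Real.log e.2 ^ a) * A.a n| ≤
          C * M * A.size x * Real.log (x / y) ^ (a + 1) / Real.log z ^ 2 := by
  have hFL := SieveSequence.fundamental_lemma_uniform_holds
  have hsize := hA.1
  have hA0 : ∀ x, 0 ≤ A.size x := SieveSequence.size_nonneg_of_size_eq hsize
  rcases density_nonneg_or_size_eq_zero A hA with hg | hzero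
  swap
  · -- degenerate case: all `a_n` vanish, `Σ₂ = 0`
    refine ⟨0, fun ε hε => Filter.Eventually.of_forall fun x y z M lam _ _ _ _ _ _ => ?_⟩
    have h0 : ∑ n ∈ Ioc 0 ⌊x⌋₊, A.a n = 0 := by
      have := hzero x
      rwa [hsize x, SieveSequence.congrSum,
        Finset.filter_true_of_mem (fun n _ => one_dvd n)] at this
    have ha : ∀ n ∈ Ioc 0 ⌊x⌋₊, A.a n = 0 :=
      (Finset.sum_eq_zero_iff_of_nonneg fun n _ => A.a_nonneg n).mp h0
    have hs : ∑ n ∈ (Ioc 0 ⌊x⌋₊).filter (fun n : ℕ => n.Coprime (primesProdBelow z)),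
        (∑ e ∈ n.divisorsAntidiagonal with y ≤ ((e.1 : ℕ) : ℝ), lam e.1 * Real.log e.2 ^ a) *
          A.a n = 0 :=
      Finset.sum_eq_zero fun n hn => by rw [ha n (Finset.mem_filter.mp hn).1, mul_zero]
    rw [hs, abs_zero]
    simp
  -- the constants: sieve dimension, fundamental lemma, Lemma 7, Lemma 8
  obtain ⟨K, hK⟩ := hasSieveDimension A hA hg
  obtain ⟨CF, hCF0, hFL'⟩ := hFL 1 K
  obtain ⟨H, -, -, η, -, C₇, h7⟩ := FI1978_lemma7_rat A hA
  obtain ⟨C₈, h8⟩ := FI1978_lemma8_rat A hA.2.1 hA.2.2.2.2.2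
  set C₇' := max C₇ 1 with hC₇'
  set C₈' := max C₈ 1 with hC₈'
  have hC₇'0 : 0 ≤ C₇' := zero_le_one.trans (le_max_right _ _)
  have hC₈'0 : 0 ≤ C₈' := zero_le_one.trans (le_max_right _ _)
  refine ⟨(1 + CF) * C₇' * C₈' + 1, fun ε hε => ?_⟩
  -- (A₂) with this `ε` and `B = 3`
  obtain ⟨C₂, hC₂⟩ := hA.2.2.1 ε hε ((3 : ℕ) : ℝ) (by norm_num)
  filter_upwards [hC₂, eventually_ge_atTop (1 : ℝ),
    Real.tendsto_log_atTop.eventually_ge_atTop (max 1 C₂)]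
    with x hx2 hx1 hxlog y z M lam hM hlam hz hzy hzx hyx
  -- the parameters
  have hx0 : 0 < x := by linarith
  have hlogx1 : 1 ≤ Real.log x := (le_max_left _ _).trans hxlog
  have hC₂log : C₂ ≤ Real.log x := (le_max_right _ _).trans hxlog
  have hz0 : 0 < z := by linarith
  have hz1 : 1 < z := by linarith
  have hsqrt1 : 1 ≤ Real.sqrt x := by
    rw [← Real.sqrt_one]
    exact Real.sqrt_le_sqrt hx1
  have hsqrt0 : 0 < Real.sqrt x := by linarith
  have hy2 : 2 ≤ y := by nlinarith
  have hy0 : 0 < y := by linarith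
  have hy1 : 1 ≤ y := by linarith
  have hyx' : y ≤ x := by
    refine hyx.le.trans ?_
    calc x ^ (1 - ε) ≤ x ^ (1 : ℝ) := Real.rpow_le_rpow_of_exponent_le hx1 (by linarith)
      _ = x := Real.rpow_one x
  have hzxy : z < x / y := by rwa [lt_div_iff₀ hy0]
  have hxy0 : 0 ≤ x / y := div_nonneg hx0.le hy0.le
  have hzx' : z ≤ x := hzxy.le.trans (div_le_self hx0.le hy1)
  have hlogz : 0 < Real.log z := Real.log_pos hz1
  have hlogxy : Real.log z ≤ Real.log (x / y) := Real.log_le_log hz0 hzxy.le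
  have hlogxy0 : 0 < Real.log (x / y) := hlogz.trans_le hlogxy
  have hlogzx : Real.log z ≤ Real.log x := Real.log_le_log hz0 hzx'
  -- the level: `z² · x/y < z √x < y < x^{1−ε}`
  have hlevel : x / y * z ^ 2 < x ^ (1 - ε) := by
    have h1 : x / y * z ^ 2 < z * Real.sqrt x := by
      rw [div_mul_eq_mul_div, div_lt_iff₀ hy0]
      have hsx : Real.sqrt x ^ 2 = x := Real.sq_sqrt hx0.le
      have h2 : Real.sqrt x * z < y := by linarith
      calc x * z ^ 2 = (Real.sqrt x * z) * (z * Real.sqrt x) := by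
            linear_combination (-(z ^ 2)) * hsx
        _ < y * (z * Real.sqrt x) := mul_lt_mul_of_pos_right h2 (mul_pos hz0 hsqrt0)
        _ = z * Real.sqrt x * y := by ring
    exact h1.trans (hzx.trans hyx)
  set P := primesProdBelow z with hP
  set V := A.densityProduct P with hV
  have hVle : V ≤ C₇' / Real.log z :=
    (h7 z hz).2.trans (div_le_div_of_nonneg_right (le_max_left _ _) hlogz.le)
  have hV0 : 0 ≤ V := by
    rw [hV, densityProduct_primesProdBelow]
    exact Finset.prod_nonneg fun p hp =>
      (sub_pos.mpr (hA.2.1.2 p (Nat.prime_of_mem_primesBelow hp).one_lt)).le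
  have hAx := hA0 x
  -- Step 1: `|Σ₂| ≤ M (log x/y)^a ∑_m S(𝒜_m, z; x)`
  have h1 := abs_sigma2Gen_le A hM a z hy0 hyx' hlam
  rw [← hP] at h1
  -- Step 2: the fundamental lemma (upper half) for each `𝒜_m`, `(m, P(z)) = 1`, at level `z²`
  have hFLm : ∀ m ∈ (Ioc 0 ⌊x / y⌋₊).filter (fun m : ℕ => m.Coprime P),
      (A.restrictDvd m).sifted x P ≤ (1 + CF) * A.size x * V * |A.density m| +
        ∑ d ∈ P.divisors.filter (fun d : ℕ => (d : ℝ) ≤ z ^ 2), |A.remainder (m * d) x| := by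
    intro m hm
    obtain ⟨hm', hmP⟩ := Finset.mem_filter.mp hm
    have hm1 : 1 ≤ m := (Finset.mem_Ioc.mp hm').1
    have hgm : 0 ≤ A.density m := hg m hm1
    have hsz : 0 ≤ A.density m * A.size x := mul_nonneg hgm hAx
    have hzz : z ≤ z ^ 2 := by nlinarith
    have h : |(A.restrictDvd m).sifted x P - A.density m * A.size x * V| ≤
        CF * (A.density m * A.size x) * V * Real.exp (-(Real.log (z ^ 2) / Real.log z)) +
          ∑ d ∈ P.divisors.filter (fun d : ℕ => (d : ℝ) ≤ z ^ 2),
            |(A.restrictDvd m).remainder d x| :=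
      hFL' (A.restrictDvd m) hK x z (z ^ 2) hz hzz hsz
    have hrem : ∑ d ∈ P.divisors.filter (fun d : ℕ => (d : ℝ) ≤ z ^ 2),
        |(A.restrictDvd m).remainder d x| =
        ∑ d ∈ P.divisors.filter (fun d : ℕ => (d : ℝ) ≤ z ^ 2), |A.remainder (m * d) x| := by
      refine Finset.sum_congr rfl fun d hd => ?_
      have hdP : d ∣ P := Nat.dvd_of_mem_divisors (Finset.mem_filter.mp hd).1
      rw [remainder_restrictDvd A (hmP.coprime_dvd_right hdP)]
    rw [hrem] at h
    have hexp : Real.exp (-(Real.log (z ^ 2) / Real.log z)) ≤ 1 := by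
      rw [Real.exp_le_one_iff, neg_nonpos]
      exact div_nonneg (Real.log_nonneg (by nlinarith)) hlogz.le
    have hup := (abs_sub_le_iff.mp h).1
    have hgAV : 0 ≤ CF * (A.density m * A.size x) * V := mul_nonneg (mul_nonneg hCF0.le hsz) hV0
    have hmain : A.density m * A.size x * V +
        CF * (A.density m * A.size x) * V * Real.exp (-(Real.log (z ^ 2) / Real.log z)) ≤
        (1 + CF) * A.size x * V * |A.density m| := by
      rw [abs_of_nonneg hgm]
      calc A.density m * A.size x * V +
            CF * (A.density m * A.size x) * V * Real.exp (-(Real.log (z ^ 2) / Real.log z))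
          ≤ A.density m * A.size x * V + CF * (A.density m * A.size x) * V * 1 := by
            gcongr
        _ = (1 + CF) * A.size x * V * A.density m := by ring
    linarith
  -- Step 3: summing over `m`: Lemma 8 for the main terms, rearrangement + (A₂) for the remainders
  have h8' : ∑ m ∈ (Ioc 0 ⌊x / y⌋₊).filter (fun m : ℕ => m.Coprime P), |A.density m| ≤
      C₈' * Real.log (x / y) / Real.log z := by
    refine (h8 (x / y) z hz hzxy.le).trans ?_
    exact div_le_div_of_nonneg_right (mul_le_mul_of_nonneg_right (le_max_left _ _) hlogxy0.le)
      hlogz.le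
  have hR : ∑ m ∈ (Ioc 0 ⌊x / y⌋₊).filter (fun m : ℕ => m.Coprime P),
      ∑ d ∈ P.divisors.filter (fun d : ℕ => (d : ℝ) ≤ z ^ 2), |A.remainder (m * d) x| ≤
      C₂ * A.size x / Real.log x ^ 3 := by
    have hM' : ∀ m ∈ (Ioc 0 ⌊x / y⌋₊).filter (fun m : ℕ => m.Coprime P), m ≠ 0 ∧ m.Coprime P :=
      fun m hm => ⟨(Finset.mem_Ioc.mp (Finset.mem_filter.mp hm).1).1.ne',
        (Finset.mem_filter.mp hm).2⟩
    have hL : ∀ m ∈ (Ioc 0 ⌊x / y⌋₊).filter (fun m : ℕ => m.Coprime P),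
        (m : ℝ) * z ^ 2 < x ^ (1 - ε) := by
      intro m hm
      have hmX : (m : ℝ) ≤ x / y :=
        (Nat.cast_le.mpr (Finset.mem_Ioc.mp (Finset.mem_filter.mp hm).1).2).trans
          (Nat.floor_le hxy0)
      exact (mul_le_mul_of_nonneg_right hmX (sq_nonneg z)).trans_lt hlevel
    have hre := sum_coprime_sum_divisors_le (primesProdBelow_ne_zero z)
      (fun q => |A.remainder q x|) (fun q => abs_nonneg _) _ hM' (z ^ 2) (x ^ (1 - ε)) hL
    refine hre.trans ?_
    have := hx2 (fun _ => x) fun _ => le_rfl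
    rwa [Real.rpow_natCast] at this
  have hsumS : ∑ m ∈ (Ioc 0 ⌊x / y⌋₊).filter (fun m : ℕ => m.Coprime P),
      (A.restrictDvd m).sifted x P ≤
      (1 + CF) * A.size x * V * (C₈' * Real.log (x / y) / Real.log z) +
        C₂ * A.size x / Real.log x ^ 3 := by
    refine (Finset.sum_le_sum hFLm).trans ?_
    rw [Finset.sum_add_distrib, ← Finset.mul_sum]
    refine add_le_add (mul_le_mul_of_nonneg_left h8' ?_) hR
    exact mul_nonneg (mul_nonneg (by linarith) hAx) hV0
  -- Step 4: arithmetic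
  have hT1 : (1 + CF) * A.size x * V * (C₈' * Real.log (x / y) / Real.log z) ≤
      (1 + CF) * C₇' * C₈' * A.size x * Real.log (x / y) / Real.log z ^ 2 := by
    have hnn : 0 ≤ (1 + CF) * A.size x * (C₈' * Real.log (x / y) / Real.log z) :=
      mul_nonneg (mul_nonneg (by linarith) hAx)
        (div_nonneg (mul_nonneg hC₈'0 hlogxy0.le) hlogz.le)
    calc (1 + CF) * A.size x * V * (C₈' * Real.log (x / y) / Real.log z)
        = (1 + CF) * A.size x * (C₈' * Real.log (x / y) / Real.log z) * V := by ring
      _ ≤ (1 + CF) * A.size x * (C₈' * Real.log (x / y) / Real.log z) * (C₇' / Real.log z) :=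
          mul_le_mul_of_nonneg_left hVle hnn
      _ = (1 + CF) * C₇' * C₈' * A.size x * Real.log (x / y) / Real.log z ^ 2 := by
          field_simp
  have hT2 : C₂ * A.size x / Real.log x ^ 3 ≤ A.size x * Real.log (x / y) / Real.log z ^ 2 := by
    have hlx0 : 0 < Real.log x := by linarith
    have ha : C₂ / Real.log x ^ 3 ≤ 1 / Real.log x := by
      rw [div_le_div_iff₀ (pow_pos hlx0 3) hlx0]
      have : C₂ * Real.log x ≤ Real.log x * Real.log x := mul_le_mul_of_nonneg_right hC₂log hlx0.le
      nlinarith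
    have hb : 1 / Real.log x ≤ 1 / Real.log z := one_div_le_one_div_of_le hlogz hlogzx
    have hc : 1 / Real.log z ≤ Real.log (x / y) / Real.log z ^ 2 := by
      rw [div_le_div_iff₀ hlogz (pow_pos hlogz 2), one_mul, pow_two]
      exact mul_le_mul_of_nonneg_right hlogxy hlogz.le
    calc C₂ * A.size x / Real.log x ^ 3 = A.size x * (C₂ / Real.log x ^ 3) := by ring
      _ ≤ A.size x * (Real.log (x / y) / Real.log z ^ 2) :=
          mul_le_mul_of_nonneg_left (ha.trans (hb.trans hc)) hAx
      _ = A.size x * Real.log (x / y) / Real.log z ^ 2 := by ring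
  have hK0 : 0 ≤ M * Real.log (x / y) ^ a := mul_nonneg hM (pow_nonneg hlogxy0.le _)
  calc |∑ n ∈ (Ioc 0 ⌊x⌋₊).filter (fun n : ℕ => n.Coprime P),
          (∑ e ∈ n.divisorsAntidiagonal with y ≤ ((e.1 : ℕ) : ℝ), lam e.1 * Real.log e.2 ^ a) *
            A.a n|
      ≤ M * Real.log (x / y) ^ a * ∑ m ∈ (Ioc 0 ⌊x / y⌋₊).filter (fun m : ℕ => m.Coprime P),
          (A.restrictDvd m).sifted x P := h1
    _ ≤ M * Real.log (x / y) ^ a * ((1 + CF) * C₇' * C₈' * A.size x * Real.log (x / y) /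
          Real.log z ^ 2 + A.size x * Real.log (x / y) / Real.log z ^ 2) :=
        mul_le_mul_of_nonneg_left (hsumS.trans (add_le_add hT1 hT2)) hK0
    _ = ((1 + CF) * C₇' * C₈' + 1) * M * A.size x * Real.log (x / y) ^ (a + 1) /
          Real.log z ^ 2 := by
        ring

/-! ### Lemma 12 for a general coefficient -/

/-- For `n ≥ 1`: `∑_{de = n, d < y} lam(d)(log e)^a = ∑_{d ∣ n, d < y} lam(d) φ_d(n)`,
`φ_d(n) = (log⁺ n/d)^a` (over the divisors instead of the antidiagonal). [folklore] -/
theorem truncLowerGen_eq_sum_divisors (lam : ℕ → ℝ) (a : ℕ) (y : ℝ) {n : ℕ} (hn : n ≠ 0) :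
    ∑ e ∈ n.divisorsAntidiagonal with ((e.1 : ℕ) : ℝ) < y, lam e.1 * Real.log e.2 ^ a =
      ∑ d ∈ n.divisors.filter (fun d : ℕ => (d : ℝ) < y),
        lam d * max 0 (Real.log ((n : ℝ) / d)) ^ a := by
  rw [Finset.sum_filter, Finset.sum_filter,
    Nat.sum_divisorsAntidiagonal (f := fun u v : ℕ =>
      if ((u : ℕ) : ℝ) < y then lam u * Real.log v ^ a else 0)]
  refine Finset.sum_congr rfl fun d hd => ?_
  have hdn : d ∣ n := Nat.dvd_of_mem_divisors hd
  have hd0 : d ≠ 0 := fun h => hn (Nat.eq_zero_of_zero_dvd (h ▸ hdn))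
  have hcast : ((n / d : ℕ) : ℝ) = (n : ℝ) / d :=
    Nat.cast_div hdn (by exact_mod_cast hd0)
  have hge : 0 ≤ Real.log ((n : ℝ) / d) := by
    refine Real.log_nonneg ?_
    rw [le_div_iff₀ (by exact_mod_cast Nat.pos_of_ne_zero hd0), one_mul]
    exact_mod_cast Nat.le_of_dvd (Nat.pos_of_ne_zero hn) hdn
  simp only [hcast, max_eq_right hge]

/-- **`Σ₁(lam, a)` over the divisor first** ([FriedlanderIwaniecPisa1978] p. 738, last display,
general coefficient): `Σ₁ = ∑_{d < y, (d, P(z)) = 1} lam(d) ∑_{n ≤ x, (n,P(z))=1, d ∣ n} a_n φ_d(n)`.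
[cite: FriedlanderIwaniecPisa1978, Lemma 12 (proof, p. 738)] -/
theorem sigma1Gen_eq_sum_mul (A : SieveSequence) (lam : ℕ → ℝ) (a : ℕ) (x y z : ℝ) :
    ∑ n ∈ (Ioc 0 ⌊x⌋₊).filter (fun n : ℕ => n.Coprime (primesProdBelow z)),
        (∑ e ∈ n.divisorsAntidiagonal with ((e.1 : ℕ) : ℝ) < y, lam e.1 * Real.log e.2 ^ a) *
          A.a n =
      ∑ d ∈ (Ico 1 ⌈y⌉₊).filter (fun d : ℕ => d.Coprime (primesProdBelow z)),
        lam d * ∑ n ∈ (Ioc 0 ⌊x⌋₊).filter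
            (fun n : ℕ => n.Coprime (primesProdBelow z) ∧ d ∣ n),
          A.a n * max 0 (Real.log ((n : ℝ) / d)) ^ a := by
  set P := primesProdBelow z with hP
  set N := ⌊x⌋₊ with hN
  set S := (Ioc 0 N).filter (fun n : ℕ => n.Coprime P) with hS
  -- Step 1: over divisors
  have h1 : ∑ n ∈ S, (∑ e ∈ n.divisorsAntidiagonal with ((e.1 : ℕ) : ℝ) < y,
      lam e.1 * Real.log e.2 ^ a) * A.a n =
      ∑ n ∈ S, ∑ d ∈ n.divisors.filter (fun d : ℕ => (d : ℝ) < y),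
        A.a n * (lam d * max 0 (Real.log ((n : ℝ) / d)) ^ a) := by
    refine Finset.sum_congr rfl fun n hn => ?_
    have hn0 : n ≠ 0 := (Finset.mem_Ioc.mp (Finset.mem_filter.mp hn).1).1.ne'
    rw [truncLowerGen_eq_sum_divisors lam a y hn0, mul_comm, Finset.mul_sum]
  -- Step 2: interchange
  have h2 : ∑ n ∈ S, ∑ d ∈ n.divisors.filter (fun d : ℕ => (d : ℝ) < y),
      A.a n * (lam d * max 0 (Real.log ((n : ℝ) / d)) ^ a) =
      ∑ d ∈ Ico 1 ⌈y⌉₊, ∑ n ∈ S.filter (fun n : ℕ => d ∣ n),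
        A.a n * (lam d * max 0 (Real.log ((n : ℝ) / d)) ^ a) := by
    refine Finset.sum_comm' fun n d => ?_
    simp only [Finset.mem_filter, Nat.mem_divisors, Finset.mem_Ico, hS, Finset.mem_Ioc]
    constructor
    · rintro ⟨⟨⟨hn0, hnN⟩, hnP⟩, ⟨hdn, -⟩, hdy⟩
      exact ⟨⟨⟨⟨hn0, hnN⟩, hnP⟩, hdn⟩, Nat.pos_of_dvd_of_pos hdn hn0, Nat.lt_ceil.mpr hdy⟩
    · rintro ⟨⟨⟨⟨hn0, hnN⟩, hnP⟩, hdn⟩, hd1, hdy⟩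
      exact ⟨⟨⟨hn0, hnN⟩, hnP⟩, ⟨hdn, hn0.ne'⟩, Nat.lt_ceil.mp hdy⟩
  rw [h1, h2]
  -- Step 3: factor `lam d` and restrict to `(d, P) = 1`
  have h3 : ∀ d : ℕ, ∑ n ∈ S.filter (fun n : ℕ => d ∣ n),
      A.a n * (lam d * max 0 (Real.log ((n : ℝ) / d)) ^ a) =
      lam d * ∑ n ∈ (Ioc 0 N).filter (fun n : ℕ => n.Coprime P ∧ d ∣ n),
        A.a n * max 0 (Real.log ((n : ℝ) / d)) ^ a := by
    intro d
    rw [hS, Finset.filter_filter, Finset.mul_sum]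
    exact Finset.sum_congr rfl fun n _ => by ring
  simp_rw [h3]
  symm
  refine Finset.sum_subset (Finset.filter_subset _ _) fun d hd hdnot => ?_
  have hdc : ¬ d.Coprime P := fun h => hdnot (Finset.mem_filter.mpr ⟨hd, h⟩)
  rw [Finset.sum_eq_zero fun n hn => ?_, mul_zero]
  obtain ⟨-, hc, hdn⟩ := Finset.mem_filter.mp hn
  exact absurd (Nat.Coprime.coprime_dvd_left hdn hc) hdc

/-- **[FriedlanderIwaniecPisa1978] Lemma 12 for a general coefficient** (and exponent `a ≥ 2`).
For a Bombieri sequence `𝒜` with constant `H` there are `η > 0` and `C` such that for every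
`ε > 0`, `s ≥ 2`, all large `x`, all `y ≥ 1`, `z ≥ 2` with `z^s y ≤ x^{1−ε}`, and every coefficient
sequence with `|lam d| ≤ M` on `1 ≤ d ≤ x` (`M ≥ 0`):
`|Σ₁(lam, a) − H A(x) F(lam, a)| ≤ C · M · (e^{−s} A(x) L^{a−1} + (∫₁^x A(t)dt/t) L^{a−2} +
z^{−η} A(x) L^a) (L/log z)²` (`L = log x`), where
`Σ₁(lam, a) = ∑_{n ≤ x,(n,P(z))=1} a_n ∑_{de=n, d<y} lam(d)(log e)^a` and
`F(lam, a) = ∏_{p<z}(1 − 1/p) ∑_{d<y,(d,P(z))=1} lam(d) d⁻¹ (log x/d)^a`. This is the printed Lemma 12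
(`O{(e^{−s} + β(x) + c(ε)/log x + z^{−η} log x) A(x)(log x)^{|k|−1}(log x/log z)²}`,
`|k| = |k'| + a`) once `M = (log x)^{|k'|}` bounds `|𝔏_(k')|`; the proof is that of the scalar case
(`FI1978_lemma12_of_fundamentalLemma`), verbatim except that `|μ(d)| ≤ 1` becomes `|lam d| ≤ M`:
`η` is that of Lemma 9, `C = C_F C₇ C₈ + 1 + a C₇ C₈ + C₉`, threshold `log x ≥ max(1, 2C₂(ε)e^s)`.
[cite: FriedlanderIwaniecPisa1978, Lemma 12] -/
theorem lemma12Gen (A : SieveSequence) (H : ℝ) (hA : A.IsBombieriSequence)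
    (hH : A.HasDensityConstant H) {a : ℕ} (ha : 2 ≤ a) :
    ∃ η : ℝ, 0 < η ∧ ∃ C : ℝ, ∀ ε : ℝ, 0 < ε → ∀ s : ℝ, 2 ≤ s → ∀ᶠ x : ℝ in atTop,
      ∀ (y z M : ℝ) (lam : ℕ → ℝ), 0 ≤ M → (∀ d : ℕ, 1 ≤ d → (d : ℝ) ≤ x → |lam d| ≤ M) →
      2 ≤ z → 1 ≤ y → z ^ s * y ≤ x ^ (1 - ε) →
        |(∑ n ∈ (Ioc 0 ⌊x⌋₊).filter (fun n : ℕ => n.Coprime (primesProdBelow z)),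
            (∑ e ∈ n.divisorsAntidiagonal with ((e.1 : ℕ) : ℝ) < y,
              lam e.1 * Real.log e.2 ^ a) * A.a n) -
          H * A.size x *
            ((∏ p ∈ Nat.primesBelow ⌈z⌉₊, (1 - (p : ℝ)⁻¹)) *
              ∑ d ∈ (Ico 1 ⌈y⌉₊).filter (fun d : ℕ => d.Coprime (primesProdBelow z)),
                lam d / d * Real.log (x / d) ^ a)| ≤
          C * M * (Real.exp (-s) * A.size x * Real.log x ^ (a - 1) +
                (∫ t in (1 : ℝ)..x, A.size t / t) * Real.log x ^ (a - 2) +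
                z ^ (-η) * A.size x * Real.log x ^ a) *
            (Real.log x / Real.log z) ^ 2 := by
  have hFL := SieveSequence.fundamental_lemma_uniform_holds
  have hsize := hA.1
  have hA0 : ∀ x, 0 ≤ A.size x := SieveSequence.size_nonneg_of_size_eq hsize
  obtain ⟨j, rfl⟩ : ∃ j, a = j + 2 := ⟨a - 2, by omega⟩
  simp only [show j + 2 - 1 = j + 1 from by omega, show j + 2 - 2 = j from by omega]
  have hAsum : ∀ x : ℝ, ∑ n ∈ Ioc 0 ⌊x⌋₊, A.a n = A.size x := fun x => by
    rw [hsize x, SieveSequence.congrSum, Finset.filter_true_of_mem (fun n _ => one_dvd n)]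
  rcases density_nonneg_or_size_eq_zero A hA with hg | hzero
  swap
  · -- degenerate case: all `a_n` vanish
    refine ⟨1, one_pos, 0, fun ε hε s hs =>
      Filter.Eventually.of_forall fun x y z M lam _ _ _ _ _ => ?_⟩
    have ha' : ∀ n ∈ Ioc 0 ⌊x⌋₊, A.a n = 0 :=
      (Finset.sum_eq_zero_iff_of_nonneg fun n _ => A.a_nonneg n).mp ((hAsum x).trans (hzero x))
    have hs1 : ∑ n ∈ (Ioc 0 ⌊x⌋₊).filter (fun n : ℕ => n.Coprime (primesProdBelow z)),
        (∑ e ∈ n.divisorsAntidiagonal with ((e.1 : ℕ) : ℝ) < y,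
          lam e.1 * Real.log e.2 ^ (j + 2)) * A.a n = 0 :=
      Finset.sum_eq_zero fun n hn => by rw [ha' n (Finset.mem_filter.mp hn).1, mul_zero]
    rw [hs1, hzero x]
    simp
  -- the constants
  obtain ⟨K, hK⟩ := hasSieveDimension A hA hg
  obtain ⟨CF, hCF0, hFL'⟩ := hFL 1 K
  obtain ⟨H₇, hH₇0, hH₇, η₇, hη₇, C₇, h7⟩ := FI1978_lemma7_rat A hA
  have hHH : H = H₇ := tendsto_nhds_unique hH hH₇
  subst hHH
  obtain ⟨C₈, h8⟩ := FI1978_lemma8_rat A hA.2.1 hA.2.2.2.2.2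
  obtain ⟨η, hη0, C₉, h9⟩ := FI1978_lemma9_rat A H hA hH
  set C₇' := max C₇ 0 with hC₇'
  set C₈' := max C₈ 0 with hC₈'
  set C₉' := max C₉ 0 with hC₉'
  have hC₇'0 : 0 ≤ C₇' := le_max_right _ _
  have hC₈'0 : 0 ≤ C₈' := le_max_right _ _
  have hC₉'0 : 0 ≤ C₉' := le_max_right _ _
  refine ⟨η, hη0, CF * C₇' * C₈' + 1 + (j + 2) * C₇' * C₈' + C₉', fun ε hε s hs => ?_⟩
  -- (A₂) with this `ε` and `B = a + 1`
  obtain ⟨C₂, hC₂⟩ := hA.2.2.1 ε hε ((j + 3 : ℕ) : ℝ) (by positivity)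
  filter_upwards [hC₂, eventually_ge_atTop (1 : ℝ),
    Real.tendsto_log_atTop.eventually_ge_atTop (max 1 (2 * C₂ * Real.exp s))]
    with x hx2 hx1 hxlog y z M lam hM hlam hz hy1 hlev
  -- the parameters
  have hx0 : 0 < x := by linarith
  have hlogx1 : 1 ≤ Real.log x := (le_max_left _ _).trans hxlog
  have hC₂log : 2 * C₂ * Real.exp s ≤ Real.log x := (le_max_right _ _).trans hxlog
  have hz0 : 0 < z := by linarith
  have hz1 : 1 < z := by linarith
  have hy0 : 0 < y := by linarith
  have hzs : z ≤ z ^ s := by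
    calc z = z ^ (1 : ℝ) := (Real.rpow_one z).symm
      _ ≤ z ^ s := Real.rpow_le_rpow_of_exponent_le hz1.le (by linarith)
  have hzs0 : 0 < z ^ s := Real.rpow_pos_of_pos hz0 s
  have hx1ε : x ^ (1 - ε) ≤ x := by
    calc x ^ (1 - ε) ≤ x ^ (1 : ℝ) := Real.rpow_le_rpow_of_exponent_le hx1 (by linarith)
      _ = x := Real.rpow_one x
  have hyx : y ≤ x := by
    have h1 : y ≤ z ^ s * y := le_mul_of_one_le_left hy0.le (hz1.le.trans hzs)
    linarith
  have hzx : z ≤ x := by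
    have h1 : z ^ s ≤ z ^ s * y := le_mul_of_one_le_right hzs0.le hy1
    linarith
  have hlogz : 0 < Real.log z := Real.log_pos hz1
  have hlogzx : Real.log z ≤ Real.log x := Real.log_le_log hz0 hzx
  have hlx0 : 0 < Real.log x := by linarith
  set N := ⌊x⌋₊ with hN
  have hNx : (N : ℝ) ≤ x := Nat.floor_le hx0.le
  set P := primesProdBelow z with hP
  set V := A.densityProduct P with hV
  set P₁ := ∏ p ∈ Nat.primesBelow ⌈z⌉₊, (1 - (p : ℝ)⁻¹) with hP₁
  set L := Real.log x with hL
  set Ax := A.size x with hAx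
  have hAx0 : 0 ≤ Ax := hA0 x
  have hV0 : 0 ≤ V := by
    rw [hV, densityProduct_primesProdBelow]
    exact Finset.prod_nonneg fun p hp =>
      (sub_pos.mpr (hA.2.1.2 p (Nat.prime_of_mem_primesBelow hp).one_lt)).le
  have hVle : V ≤ C₇' / Real.log z :=
    (h7 z hz).2.trans (div_le_div_of_nonneg_right (le_max_left _ _) hlogz.le)
  -- the auxiliary height `X₁ = max y z ≤ x` for Lemmata 8, 9
  set X₁ := max y z with hX₁
  have hzX₁ : z ≤ X₁ := le_max_right _ _
  have hX₁x : X₁ ≤ x := max_le hyx hzx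
  have hlogX₁ : Real.log X₁ ≤ L := Real.log_le_log (hz0.trans_le hzX₁) hX₁x
  set M₁ := (Ico 1 ⌈y⌉₊).filter (fun d : ℕ => d.Coprime P) with hM₁
  have hmemM : ∀ {d : ℕ}, d ∈ M₁ → (1 ≤ d ∧ (d : ℝ) < y) ∧ d.Coprime P := by
    intro d hd
    obtain ⟨hd', hdP⟩ := Finset.mem_filter.mp hd
    obtain ⟨hd1, hdy⟩ := Finset.mem_Ico.mp hd'
    exact ⟨⟨hd1, Nat.lt_ceil.mp hdy⟩, hdP⟩
  have hMsub : M₁ ⊆ (Ioc 0 ⌊X₁⌋₊).filter (fun d : ℕ => d.Coprime P) := by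
    intro d hd
    obtain ⟨⟨hd1, hdy⟩, hdP⟩ := hmemM hd
    refine Finset.mem_filter.mpr ⟨Finset.mem_Ioc.mpr ⟨hd1, Nat.le_floor ?_⟩, hdP⟩
    exact hdy.le.trans (le_max_left _ _)
  -- Lemma 8 and Lemma 9 over `M₁`
  have hG : ∑ d ∈ M₁, |A.density d| ≤ C₈' * L / Real.log z := by
    refine (Finset.sum_le_sum_of_subset_of_nonneg hMsub fun _ _ _ => abs_nonneg _).trans ?_
    refine (h8 X₁ z hz hzX₁).trans ?_
    rw [div_le_div_iff_of_pos_right hlogz]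
    exact mul_le_mul (le_max_left _ _) hlogX₁ (Real.log_nonneg (hz1.le.trans hzX₁)) hC₈'0
  have hS9 : ∑ d ∈ M₁, |A.density d * V - H * P₁ / d| ≤ C₉' * z ^ (-η) * L / Real.log z := by
    refine (Finset.sum_le_sum_of_subset_of_nonneg hMsub fun _ _ _ => abs_nonneg _).trans ?_
    refine (h9 X₁ z hz hzX₁).trans ?_
    rw [div_le_div_iff_of_pos_right hlogz]
    have hzη : 0 ≤ z ^ (-η) := Real.rpow_nonneg hz0.le _
    exact mul_le_mul (mul_le_mul_of_nonneg_right (le_max_left _ _) hzη) hlogX₁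
      (Real.log_nonneg (hz1.le.trans hzX₁)) (mul_nonneg hC₉'0 hzη)
  -- the weights `φ_d`, the sums `T_d`, `W_d`, and `β`
  set w : ℕ → ℕ → ℝ := fun d n => max 0 (Real.log ((n : ℝ) / d)) ^ (j + 2) with hw
  set T : ℕ → ℝ := fun d => ∑ n ∈ Ioc 0 N, A.a n * w d n with hT
  set W : ℕ → ℝ := fun d =>
    ∑ n ∈ (Ioc 0 N).filter (fun n : ℕ => n.Coprime P ∧ d ∣ n), A.a n * w d n with hW
  set I := ∑ n ∈ Ioc 0 N, A.a n * (L - Real.log n) with hI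
  have hIeq : ∫ t in (1 : ℝ)..x, A.size t / t = I := integral_size_div_eq A hsize hx1
  have hI0 : 0 ≤ I := Finset.sum_nonneg fun n hn => by
    have hn := Finset.mem_Ioc.mp hn
    refine mul_nonneg (A.a_nonneg n) (sub_nonneg.mpr (Real.log_le_log ?_ ?_))
    · exact_mod_cast hn.1
    · exact (Nat.cast_le.mpr hn.2).trans hNx
  have hwprops : ∀ {d : ℕ}, 1 ≤ d → (∀ n, 0 ≤ w d n) ∧ Monotone (w d) ∧
      ∀ n : ℕ, d ∣ n → 1 ≤ n → w d n = Real.log ((n : ℝ) / d) ^ (j + 2) :=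
    fun hd => logWeight_props (j + 2) hd fun n => rfl
  have hwN : ∀ {d : ℕ}, 1 ≤ d → w d N ≤ L ^ (j + 2) := by
    intro d hd
    have hd0 : (0 : ℝ) < d := by exact_mod_cast hd
    refine pow_le_pow_left₀ (le_max_left _ _) (max_le hlx0.le ?_) _
    rcases Nat.eq_zero_or_pos N with hN0 | hNpos
    · rw [hN0, Nat.cast_zero, zero_div, Real.log_zero]
      exact hlx0.le
    · calc Real.log ((N : ℝ) / d) ≤ Real.log N :=
            Real.log_le_log (div_pos (by exact_mod_cast hNpos) hd0)
              (div_le_self (Nat.cast_nonneg N) (by exact_mod_cast hd))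
        _ ≤ L := Real.log_le_log (by exact_mod_cast hNpos) hNx
  -- `T_d` against `A(x) (log x/d)^a`
  have hTd : ∀ {d : ℕ}, d ∈ M₁ →
      0 ≤ Ax * Real.log (x / d) ^ (j + 2) - T d ∧
        Ax * Real.log (x / d) ^ (j + 2) - T d ≤ (j + 2 : ℕ) * L ^ (j + 1) * I ∧
        T d ≤ Ax * L ^ (j + 2) := by
    intro d hd
    obtain ⟨⟨hd1, hdy⟩, -⟩ := hmemM hd
    have hdx : (d : ℝ) ≤ x := hdy.le.trans hyx
    have h := size_mul_pow_log_sub_weightedSum_bounds A (k := j + 2) hd1 hdx (w := w d)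
      fun n => rfl
    rw [hAsum x, show j + 2 - 1 = j + 1 from by omega] at h
    refine ⟨h.1, h.2, ?_⟩
    have hd0 : (0 : ℝ) < d := by exact_mod_cast hd1
    have hlxd : Real.log (x / d) ≤ L := by
      rw [Real.log_div hx0.ne' hd0.ne']
      linarith [Real.log_nonneg (show (1 : ℝ) ≤ d by exact_mod_cast hd1)]
    have hlxd0 : 0 ≤ Real.log (x / d) := Real.log_nonneg ((one_le_div hd0).mpr hdx)
    calc T d ≤ Ax * Real.log (x / d) ^ (j + 2) := by linarith [h.1]
      _ ≤ Ax * L ^ (j + 2) := mul_le_mul_of_nonneg_left (pow_le_pow_left₀ hlxd0 hlxd _) hAx0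
  -- the selection `m_q ≤ N` maximising `|R(m; q)|`, and (A₂)
  have hne : (Finset.range (N + 1)).Nonempty := ⟨0, by simp⟩
  choose msel hmsel using fun q : ℕ =>
    Finset.exists_max_image (Finset.range (N + 1)) (fun m : ℕ => |A.remainder q (m : ℝ)|) hne
  set Rstar : ℕ → ℝ := fun q => |A.remainder q (msel q : ℝ)| with hRstar
  have hRstar0 : ∀ q, 0 ≤ Rstar q := fun q => abs_nonneg _
  have hRle : ∀ q m : ℕ, m ≤ N → |A.remainder q (m : ℝ)| ≤ Rstar q := fun q m hm =>
    (hmsel q).2 m (Finset.mem_range.mpr (Nat.lt_succ_of_le hm))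
  have hA2 : ∑ q ∈ Ico 1 ⌈x ^ (1 - ε)⌉₊, Rstar q ≤ C₂ * Ax / L ^ (j + 3) := by
    have h := hx2 (fun q => (msel q : ℝ)) fun q =>
      (Nat.cast_le.mpr (Nat.lt_succ_iff.mp (Finset.mem_range.mp (hmsel q).1))).trans hNx
    rwa [Real.rpow_natCast] at h
  -- Step 1: `Σ₁` over `d` first
  have hSig : ∑ n ∈ (Ioc 0 ⌊x⌋₊).filter (fun n : ℕ => n.Coprime (primesProdBelow z)),
      (∑ e ∈ n.divisorsAntidiagonal with ((e.1 : ℕ) : ℝ) < y,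
        lam e.1 * Real.log e.2 ^ (j + 2)) * A.a n = ∑ d ∈ M₁, lam d * W d := by
    rw [sigma1Gen_eq_sum_mul]
  -- Step 2: the sieve bound for each `d ∈ M₁`
  have hWd : ∀ {d : ℕ}, d ∈ M₁ → |W d - A.density d * T d * V| ≤
      CF * Real.exp (-s) * V * Ax * L ^ (j + 2) * |A.density d| +
        2 * L ^ (j + 2) * ∑ ν ∈ P.divisors.filter (fun ν : ℕ => (ν : ℝ) ≤ z ^ s),
          Rstar (d * ν) := by
    intro d hd
    obtain ⟨⟨hd1, hdy⟩, hdP⟩ := hmemM hd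
    have hgd : 0 ≤ A.density d := hg d hd1
    obtain ⟨hw0, hwmono, -⟩ := hwprops hd1
    have h := weighted_sifted_sub_le hFL' A hK hw0 hgd hdP x (z ^ s) hz hzs
    have hexp : Real.exp (-(Real.log (z ^ s) / Real.log z)) = Real.exp (-s) := by
      rw [Real.log_rpow hz0, mul_div_assoc, div_self hlogz.ne', mul_one]
    rw [hexp] at h
    -- the remainders
    have hrem : ∀ ν ∈ P.divisors.filter (fun ν : ℕ => (ν : ℝ) ≤ z ^ s),
        |(∑ n ∈ (Ioc 0 N).filter (fun n : ℕ => d * ν ∣ n), A.a n * w d n) -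
            A.density (d * ν) * ∑ n ∈ Ioc 0 N, A.a n * w d n| ≤
          2 * L ^ (j + 2) * Rstar (d * ν) := by
      intro ν hν
      refine (abs_weighted_congrSum_sub_le A hsize hw0 hwmono (d * ν) N
        (fun m hm => hRle (d * ν) m hm)).trans ?_
      calc 2 * Rstar (d * ν) * w d N ≤ 2 * Rstar (d * ν) * L ^ (j + 2) :=
            mul_le_mul_of_nonneg_left (hwN hd1) (mul_nonneg zero_le_two (hRstar0 _))
        _ = 2 * L ^ (j + 2) * Rstar (d * ν) := by ring
    have hmain : CF * (A.density d * T d) * V * Real.exp (-s) ≤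
        CF * Real.exp (-s) * V * Ax * L ^ (j + 2) * |A.density d| := by
      rw [abs_of_nonneg hgd]
      have hT3 := (hTd hd).2.2
      calc CF * (A.density d * T d) * V * Real.exp (-s)
          = (CF * Real.exp (-s) * V * A.density d) * T d := by ring
        _ ≤ (CF * Real.exp (-s) * V * A.density d) * (Ax * L ^ (j + 2)) :=
            mul_le_mul_of_nonneg_left hT3 (mul_nonneg (mul_nonneg (mul_nonneg hCF0.le
              (Real.exp_pos _).le) hV0) hgd)
        _ = CF * Real.exp (-s) * V * Ax * L ^ (j + 2) * A.density d := by ring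
    calc |W d - A.density d * T d * V|
        ≤ CF * (A.density d * T d) * V * Real.exp (-s) +
            ∑ ν ∈ P.divisors.filter (fun ν : ℕ => (ν : ℝ) ≤ z ^ s),
              |(∑ n ∈ (Ioc 0 N).filter (fun n : ℕ => d * ν ∣ n), A.a n * w d n) -
                  A.density (d * ν) * ∑ n ∈ Ioc 0 N, A.a n * w d n| := h
      _ ≤ CF * Real.exp (-s) * V * Ax * L ^ (j + 2) * |A.density d| +
            ∑ ν ∈ P.divisors.filter (fun ν : ℕ => (ν : ℝ) ≤ z ^ s),
              2 * L ^ (j + 2) * Rstar (d * ν) := add_le_add hmain (Finset.sum_le_sum hrem)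
      _ = _ := by rw [Finset.mul_sum]
  -- Step 3: the term-by-term bound for `Σ₁ − H A(x) F`
  have hterm : ∀ d ∈ M₁,
      |lam d * W d - H * Ax * (P₁ * (lam d / d * Real.log (x / d) ^ (j + 2)))| ≤
        M * (CF * Real.exp (-s) * V * Ax * L ^ (j + 2) * |A.density d| +
          2 * L ^ (j + 2) * ∑ ν ∈ P.divisors.filter (fun ν : ℕ => (ν : ℝ) ≤ z ^ s),
            Rstar (d * ν) +
          (j + 2 : ℕ) * L ^ (j + 1) * I * V * |A.density d| +
          Ax * L ^ (j + 2) * |A.density d * V - H * P₁ / d|) := by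
    intro d hd
    obtain ⟨⟨hd1, hdy⟩, hdP⟩ := hmemM hd
    have hgd : 0 ≤ A.density d := hg d hd1
    have hd0 : (0 : ℝ) < d := by exact_mod_cast hd1
    have hdx : (d : ℝ) ≤ x := hdy.le.trans hyx
    have hlxd : Real.log (x / d) ≤ L := by
      rw [Real.log_div hx0.ne' hd0.ne']
      linarith [Real.log_nonneg (show (1 : ℝ) ≤ d by exact_mod_cast hd1)]
    have hlxd0 : 0 ≤ Real.log (x / d) := Real.log_nonneg ((one_le_div hd0).mpr hdx)
    obtain ⟨hT1, hT2, -⟩ := hTd hd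
    have hlamd : |lam d| ≤ M := hlam d hd1 hdx
    have hid : lam d * W d - H * Ax * (P₁ * (lam d / d * Real.log (x / d) ^ (j + 2))) =
        lam d * ((W d - A.density d * T d * V) +
          A.density d * V * (T d - Ax * Real.log (x / d) ^ (j + 2)) +
          Ax * Real.log (x / d) ^ (j + 2) * (A.density d * V - H * P₁ / d)) := by ring
    rw [hid, abs_mul]
    refine mul_le_mul hlamd ?_ (abs_nonneg _) hM
    refine (abs_add_three _ _ _).trans ?_
    have h2 : |A.density d * V * (T d - Ax * Real.log (x / d) ^ (j + 2))| ≤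
        (j + 2 : ℕ) * L ^ (j + 1) * I * V * |A.density d| := by
      rw [abs_of_nonneg hgd, show A.density d * V * (T d - Ax * Real.log (x / d) ^ (j + 2)) =
        -(A.density d * V * (Ax * Real.log (x / d) ^ (j + 2) - T d)) by ring, abs_neg,
        abs_of_nonneg (mul_nonneg (mul_nonneg hgd hV0) hT1)]
      calc A.density d * V * (Ax * Real.log (x / d) ^ (j + 2) - T d)
          ≤ A.density d * V * ((j + 2 : ℕ) * L ^ (j + 1) * I) :=
            mul_le_mul_of_nonneg_left hT2 (mul_nonneg hgd hV0)
        _ = (j + 2 : ℕ) * L ^ (j + 1) * I * V * A.density d := by ring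
    have h3 : |Ax * Real.log (x / d) ^ (j + 2) * (A.density d * V - H * P₁ / d)| ≤
        Ax * L ^ (j + 2) * |A.density d * V - H * P₁ / d| := by
      rw [abs_mul, abs_of_nonneg (mul_nonneg hAx0 (pow_nonneg hlxd0 _))]
      exact mul_le_mul_of_nonneg_right
        (mul_le_mul_of_nonneg_left (pow_le_pow_left₀ hlxd0 hlxd _) hAx0) (abs_nonneg _)
    linarith [hWd hd, h2, h3]
  -- Step 4: summing over `d ∈ M₁`
  have hF : H * Ax * (P₁ * ∑ d ∈ M₁, lam d / d * Real.log (x / d) ^ (j + 2)) =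
      ∑ d ∈ M₁, H * Ax * (P₁ * (lam d / d * Real.log (x / d) ^ (j + 2))) := by
    rw [Finset.mul_sum, Finset.mul_sum]
  have hRR : ∑ d ∈ M₁, ∑ ν ∈ P.divisors.filter (fun ν : ℕ => (ν : ℝ) ≤ z ^ s), Rstar (d * ν) ≤
      C₂ * Ax / L ^ (j + 3) := by
    have hM' : ∀ m ∈ M₁, m ≠ 0 ∧ m.Coprime P := fun m hm =>
      ⟨by have := (hmemM hm).1.1; omega, (hmemM hm).2⟩
    have hL' : ∀ m ∈ M₁, (m : ℝ) * z ^ s < x ^ (1 - ε) := by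
      intro m hm
      have hmy := (hmemM hm).1.2
      calc (m : ℝ) * z ^ s < y * z ^ s := mul_lt_mul_of_pos_right hmy hzs0
        _ = z ^ s * y := mul_comm _ _
        _ ≤ x ^ (1 - ε) := hlev
    exact (sum_coprime_sum_divisors_le (primesProdBelow_ne_zero z) Rstar hRstar0 M₁ hM' (z ^ s)
      (x ^ (1 - ε)) hL').trans hA2
  have hsum : ∑ d ∈ M₁, (CF * Real.exp (-s) * V * Ax * L ^ (j + 2) * |A.density d| +
          2 * L ^ (j + 2) * ∑ ν ∈ P.divisors.filter (fun ν : ℕ => (ν : ℝ) ≤ z ^ s),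
            Rstar (d * ν) +
          (j + 2 : ℕ) * L ^ (j + 1) * I * V * |A.density d| +
          Ax * L ^ (j + 2) * |A.density d * V - H * P₁ / d|) ≤
      CF * Real.exp (-s) * V * Ax * L ^ (j + 2) * (C₈' * L / Real.log z) +
        2 * L ^ (j + 2) * (C₂ * Ax / L ^ (j + 3)) +
        (j + 2 : ℕ) * L ^ (j + 1) * I * V * (C₈' * L / Real.log z) +
        Ax * L ^ (j + 2) * (C₉' * z ^ (-η) * L / Real.log z) := by
    rw [Finset.sum_add_distrib, Finset.sum_add_distrib, Finset.sum_add_distrib,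
      ← Finset.mul_sum, ← Finset.mul_sum, ← Finset.mul_sum, ← Finset.mul_sum]
    have hg_sum : ∑ d ∈ M₁, |A.density d| ≤ C₈' * L / Real.log z := hG
    have hc1 : 0 ≤ CF * Real.exp (-s) * V * Ax * L ^ (j + 2) :=
      mul_nonneg (mul_nonneg (mul_nonneg (mul_nonneg hCF0.le (Real.exp_pos _).le) hV0) hAx0)
        (pow_nonneg hlx0.le _)
    have hc2 : 0 ≤ 2 * L ^ (j + 2) := mul_nonneg zero_le_two (pow_nonneg hlx0.le _)
    have hc3 : 0 ≤ (j + 2 : ℕ) * L ^ (j + 1) * I * V :=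
      mul_nonneg (mul_nonneg (mul_nonneg (Nat.cast_nonneg _) (pow_nonneg hlx0.le _)) hI0) hV0
    have hc4 : 0 ≤ Ax * L ^ (j + 2) := mul_nonneg hAx0 (pow_nonneg hlx0.le _)
    gcongr
  -- Step 5: the final shape
  have hQ1 : 1 ≤ L / Real.log z := by rwa [le_div_iff₀ hlogz, one_mul]
  have hQ : L / Real.log z ≤ (L / Real.log z) ^ 2 := le_self_pow₀ hQ1 two_ne_zero
  have hLj1 : 1 ≤ L ^ (j + 1) := one_le_pow₀ hlogx1
  have hes0 : 0 < Real.exp (-s) := Real.exp_pos _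
  have hzη : 0 ≤ z ^ (-η) := Real.rpow_nonneg hz0.le _
  -- term 1
  have ht1 : CF * Real.exp (-s) * V * Ax * L ^ (j + 2) * (C₈' * L / Real.log z) ≤
      CF * C₇' * C₈' * (Real.exp (-s) * Ax * L ^ (j + 1)) * (L / Real.log z) ^ 2 := by
    have hnn : 0 ≤ CF * Real.exp (-s) * Ax * L ^ (j + 2) * (C₈' * L / Real.log z) :=
      mul_nonneg (mul_nonneg (mul_nonneg (mul_nonneg hCF0.le hes0.le) hAx0)
        (pow_nonneg hlx0.le _)) (div_nonneg (mul_nonneg hC₈'0 hlx0.le) hlogz.le)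
    calc CF * Real.exp (-s) * V * Ax * L ^ (j + 2) * (C₈' * L / Real.log z)
        = CF * Real.exp (-s) * Ax * L ^ (j + 2) * (C₈' * L / Real.log z) * V := by ring
      _ ≤ CF * Real.exp (-s) * Ax * L ^ (j + 2) * (C₈' * L / Real.log z) *
            (C₇' / Real.log z) := mul_le_mul_of_nonneg_left hVle hnn
      _ = CF * C₇' * C₈' * (Real.exp (-s) * Ax * L ^ (j + 1)) * (L / Real.log z) ^ 2 := by
          field_simp
          ring
  -- term 2
  have ht2 : 2 * L ^ (j + 2) * (C₂ * Ax / L ^ (j + 3)) ≤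
      1 * (Real.exp (-s) * Ax * L ^ (j + 1)) * (L / Real.log z) ^ 2 := by
    have h2C : 2 * C₂ ≤ L * Real.exp (-s) := by
      have h1 : 2 * C₂ * Real.exp s * Real.exp (-s) ≤ L * Real.exp (-s) :=
        mul_le_mul_of_nonneg_right hC₂log hes0.le
      rwa [mul_assoc, ← Real.exp_add, add_neg_cancel, Real.exp_zero, mul_one] at h1
    have hLpow : L ^ (j + 3) = L ^ (j + 2) * L := by ring
    calc 2 * L ^ (j + 2) * (C₂ * Ax / L ^ (j + 3))
        = (2 * C₂) * Ax / L := by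
          rw [hLpow]
          field_simp
      _ ≤ (L * Real.exp (-s)) * Ax / L :=
          div_le_div_of_nonneg_right (mul_le_mul_of_nonneg_right h2C hAx0) hlx0.le
      _ = Real.exp (-s) * Ax := by field_simp
      _ ≤ Real.exp (-s) * Ax * L ^ (j + 1) := le_mul_of_one_le_right (mul_nonneg hes0.le hAx0) hLj1
      _ ≤ Real.exp (-s) * Ax * L ^ (j + 1) * (L / Real.log z) ^ 2 :=
          le_mul_of_one_le_right (mul_nonneg (mul_nonneg hes0.le hAx0) (zero_le_one.trans hLj1))
            (one_le_pow₀ hQ1)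
      _ = 1 * (Real.exp (-s) * Ax * L ^ (j + 1)) * (L / Real.log z) ^ 2 := by ring
  -- term 3
  have ht3 : (j + 2 : ℕ) * L ^ (j + 1) * I * V * (C₈' * L / Real.log z) ≤
      (j + 2 : ℕ) * C₇' * C₈' * (I * L ^ j) * (L / Real.log z) ^ 2 := by
    have hnn : 0 ≤ (j + 2 : ℕ) * L ^ (j + 1) * I * (C₈' * L / Real.log z) :=
      mul_nonneg (mul_nonneg (mul_nonneg (Nat.cast_nonneg _) (pow_nonneg hlx0.le _)) hI0)
        (div_nonneg (mul_nonneg hC₈'0 hlx0.le) hlogz.le)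
    calc (j + 2 : ℕ) * L ^ (j + 1) * I * V * (C₈' * L / Real.log z)
        = (j + 2 : ℕ) * L ^ (j + 1) * I * (C₈' * L / Real.log z) * V := by ring
      _ ≤ (j + 2 : ℕ) * L ^ (j + 1) * I * (C₈' * L / Real.log z) * (C₇' / Real.log z) :=
          mul_le_mul_of_nonneg_left hVle hnn
      _ = (j + 2 : ℕ) * C₇' * C₈' * (I * L ^ j) * (L / Real.log z) ^ 2 := by
          field_simp
          ring
  -- term 4
  have ht4 : Ax * L ^ (j + 2) * (C₉' * z ^ (-η) * L / Real.log z) ≤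
      C₉' * (z ^ (-η) * Ax * L ^ (j + 2)) * (L / Real.log z) ^ 2 := by
    calc Ax * L ^ (j + 2) * (C₉' * z ^ (-η) * L / Real.log z)
        = C₉' * (z ^ (-η) * Ax * L ^ (j + 2)) * (L / Real.log z) := by ring
      _ ≤ C₉' * (z ^ (-η) * Ax * L ^ (j + 2)) * (L / Real.log z) ^ 2 :=
          mul_le_mul_of_nonneg_left hQ (mul_nonneg hC₉'0 (mul_nonneg (mul_nonneg hzη hAx0)
            (pow_nonneg hlx0.le _)))
  -- the inner sum is bounded by `C (E₁ + E₂ + E₃) Q`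
  have hinner : ∑ d ∈ M₁, (CF * Real.exp (-s) * V * Ax * L ^ (j + 2) * |A.density d| +
          2 * L ^ (j + 2) * ∑ ν ∈ P.divisors.filter (fun ν : ℕ => (ν : ℝ) ≤ z ^ s),
            Rstar (d * ν) +
          (j + 2 : ℕ) * L ^ (j + 1) * I * V * |A.density d| +
          Ax * L ^ (j + 2) * |A.density d * V - H * P₁ / d|) ≤
      (CF * C₇' * C₈' + 1 + (j + 2) * C₇' * C₈' + C₉') *
        (Real.exp (-s) * Ax * L ^ (j + 1) + I * L ^ j + z ^ (-η) * Ax * L ^ (j + 2)) *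
          (L / Real.log z) ^ 2 := by
    push_cast at ht3 hsum ⊢
    have hQ0 : 0 ≤ (L / Real.log z) ^ 2 := sq_nonneg _
    have hE₁0 : 0 ≤ Real.exp (-s) * Ax * L ^ (j + 1) :=
      mul_nonneg (mul_nonneg hes0.le hAx0) (pow_nonneg hlx0.le _)
    have hE₂0 : 0 ≤ I * L ^ j := mul_nonneg hI0 (pow_nonneg hlx0.le _)
    have hE₃0 : 0 ≤ z ^ (-η) * Ax * L ^ (j + 2) :=
      mul_nonneg (mul_nonneg hzη hAx0) (pow_nonneg hlx0.le _)
    have ha0 : 0 ≤ CF * C₇' * C₈' := mul_nonneg (mul_nonneg hCF0.le hC₇'0) hC₈'0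
    have hb0 : 0 ≤ ((j : ℝ) + 2) * C₇' * C₈' :=
      mul_nonneg (mul_nonneg (by positivity) hC₇'0) hC₈'0
    have h4 := hsum.trans (add_le_add (add_le_add (add_le_add ht1 ht2) ht3) ht4)
    clear ht1 ht2 ht3 ht4 hsum hterm hWd hF hRR hSig hTd hwN hwprops hA2 hRle hmsel
    generalize (L / Real.log z) ^ 2 = Q at hQ0 h4 ⊢
    generalize Real.exp (-s) * Ax * L ^ (j + 1) = E₁ at hE₁0 h4 ⊢
    generalize I * L ^ j = E₂ at hE₂0 h4 ⊢
    generalize z ^ (-η) * Ax * L ^ (j + 2) = E₃ at hE₃0 h4 ⊢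
    generalize CF * C₇' * C₈' = a at ha0 h4 ⊢
    generalize ((j : ℝ) + 2) * C₇' * C₈' = b at hb0 h4 ⊢
    have hid : (a + 1 + b + C₉') * (E₁ + E₂ + E₃) * Q -
        (a * E₁ * Q + 1 * E₁ * Q + b * E₂ * Q + C₉' * E₃ * Q) =
        Q * (a * (E₂ + E₃) + (E₂ + E₃) + b * (E₁ + E₃) + C₉' * (E₁ + E₂)) := by ring
    have h0 : 0 ≤ Q * (a * (E₂ + E₃) + (E₂ + E₃) + b * (E₁ + E₃) + C₉' * (E₁ + E₂)) :=
      mul_nonneg hQ0 (add_nonneg (add_nonneg (add_nonneg (mul_nonneg ha0 (add_nonneg hE₂0 hE₃0))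
        (add_nonneg hE₂0 hE₃0)) (mul_nonneg hb0 (add_nonneg hE₁0 hE₃0)))
        (mul_nonneg hC₉'0 (add_nonneg hE₁0 hE₂0)))
    linarith only [h4, hid, h0]
  -- conclusion
  rw [hIeq, hSig, hF, ← Finset.sum_sub_distrib]
  refine (Finset.abs_sum_le_sum_abs _ _).trans ?_
  refine (Finset.sum_le_sum hterm).trans ?_
  rw [← Finset.mul_sum]
  calc M * ∑ d ∈ M₁, (CF * Real.exp (-s) * V * Ax * L ^ (j + 2) * |A.density d| +
          2 * L ^ (j + 2) * ∑ ν ∈ P.divisors.filter (fun ν : ℕ => (ν : ℝ) ≤ z ^ s),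
            Rstar (d * ν) +
          (j + 2 : ℕ) * L ^ (j + 1) * I * V * |A.density d| +
          Ax * L ^ (j + 2) * |A.density d * V - H * P₁ / d|)
      ≤ M * ((CF * C₇' * C₈' + 1 + (j + 2) * C₇' * C₈' + C₉') *
          (Real.exp (-s) * Ax * L ^ (j + 1) + I * L ^ j + z ^ (-η) * Ax * L ^ (j + 2)) *
            (L / Real.log z) ^ 2) := mul_le_mul_of_nonneg_left hinner hM
    _ = (CF * C₇' * C₈' + 1 + (j + 2) * C₇' * C₈' + C₉') * M *
          (Real.exp (-s) * Ax * L ^ (j + 1) + I * L ^ j + z ^ (-η) * Ax * L ^ (j + 2)) *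
            (L / Real.log z) ^ 2 := by ring

/-! ### The dissection and the three lemmata combined, for the vector weight `Λ_(k', a)` -/

/-- **The dissection for the vector weight** ([FriedlanderIwaniecPisa1978] p. 735, "We begin by
dividing the sum `∑_{n ≤ x} a_n Λ_{(k)}(n)` into three parts"): with `(k) = (k', a)`, `a ≥ 1`,
`𝔏 = Λ_(k') ∗ μ`, `∑_{n ≤ x} a_n Λ_(k)(n) = Σ₀ + Σ₁(𝔏, a) + Σ₂(𝔏, a)`, where `Σ₀` runs over the
`n` with `(n, P(z)) > 1` and `Σ₁, Σ₂` over the `n` coprime to `P(z)` with the divisor `d` of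
`Λ_(k)(n) = ∑_{de = n} 𝔏(d)(log e)^a` restricted to `d < y`, resp. `d ≥ y`.
[cite: FriedlanderIwaniecPisa1978, p. 735] -/
theorem sum_lambdaVec_mul_eq_three (A : SieveSequence) (ks : List ℕ) {a : ℕ} (ha : 0 < a)
    (x y z : ℝ) :
    ∑ n ∈ Ioc 0 ⌊x⌋₊, ((ks ++ [a]).map generalizedVonMangoldt).prod n * A.a n =
      (∑ n ∈ (Ioc 0 ⌊x⌋₊).filter (fun n : ℕ => ¬ n.Coprime (primesProdBelow z)),
          ((ks ++ [a]).map generalizedVonMangoldt).prod n * A.a n) +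
      (∑ n ∈ (Ioc 0 ⌊x⌋₊).filter (fun n : ℕ => n.Coprime (primesProdBelow z)),
          (∑ e ∈ n.divisorsAntidiagonal with ((e.1 : ℕ) : ℝ) < y,
            ((ks.map generalizedVonMangoldt).prod * (μ : ArithmeticFunction ℝ)) e.1 *
              Real.log e.2 ^ a) * A.a n) +
      (∑ n ∈ (Ioc 0 ⌊x⌋₊).filter (fun n : ℕ => n.Coprime (primesProdBelow z)),
          (∑ e ∈ n.divisorsAntidiagonal with y ≤ ((e.1 : ℕ) : ℝ),
            ((ks.map generalizedVonMangoldt).prod * (μ : ArithmeticFunction ℝ)) e.1 *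
              Real.log e.2 ^ a) * A.a n) := by
  rw [add_assoc, ← Finset.sum_add_distrib]
  have h : ∀ n ∈ (Ioc 0 ⌊x⌋₊).filter (fun n : ℕ => n.Coprime (primesProdBelow z)),
      (∑ e ∈ n.divisorsAntidiagonal with ((e.1 : ℕ) : ℝ) < y,
          ((ks.map generalizedVonMangoldt).prod * (μ : ArithmeticFunction ℝ)) e.1 *
            Real.log e.2 ^ a) * A.a n +
        (∑ e ∈ n.divisorsAntidiagonal with y ≤ ((e.1 : ℕ) : ℝ),
          ((ks.map generalizedVonMangoldt).prod * (μ : ArithmeticFunction ℝ)) e.1 *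
            Real.log e.2 ^ a) * A.a n =
        ((ks ++ [a]).map generalizedVonMangoldt).prod n * A.a n := fun n _ => by
    rw [← add_mul, lambdaVec_concat_apply ks ha n]
    congr 1
    have hf : (n.divisorsAntidiagonal.filter fun e : ℕ × ℕ => y ≤ ((e.1 : ℕ) : ℝ)) =
        n.divisorsAntidiagonal.filter fun e : ℕ × ℕ => ¬ ((e.1 : ℕ) : ℝ) < y :=
      Finset.filter_congr fun e _ => by rw [not_lt]
    rw [hf]
    exact Finset.sum_filter_add_sum_filter_not n.divisorsAntidiagonal
      (fun e : ℕ × ℕ => ((e.1 : ℕ) : ℝ) < y) _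
  rw [Finset.sum_congr rfl h, add_comm]
  exact (Finset.sum_filter_add_sum_filter_not _ _ _).symm

/-- `Σ₀` for the vector weight is dominated by the scalar `Σ₀` (`a_n ≥ 0`,
`Λ_(k) ≤ 2^{|k|} Λ_{|k|}`): `∑_{n ≤ x, (n,P(z))>1} a_n Λ_(k)(n) ≤ 2^{|k|} Σ₀(Λ_{|k|})`. [folklore] -/
theorem sigma0Vec_le (A : SieveSequence) (ks : List ℕ) (x z : ℝ) :
    ∑ n ∈ (Ioc 0 ⌊x⌋₊).filter (fun n : ℕ => ¬ n.Coprime (primesProdBelow z)),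
        (ks.map generalizedVonMangoldt).prod n * A.a n ≤
      2 ^ ks.sum * sigma0 A ks.sum x z := by
  rw [sigma0, Finset.mul_sum]
  refine Finset.sum_le_sum fun n _ => ?_
  rw [← mul_assoc]
  exact mul_le_mul_of_nonneg_right (lambdaVec_le ks n) (A.a_nonneg n)

/-- `Σ₀ ≥ 0` for the vector weight. [folklore] -/
theorem sigma0Vec_nonneg (A : SieveSequence) (ks : List ℕ) (x z : ℝ) :
    0 ≤ ∑ n ∈ (Ioc 0 ⌊x⌋₊).filter (fun n : ℕ => ¬ n.Coprime (primesProdBelow z)),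
        (ks.map generalizedVonMangoldt).prod n * A.a n :=
  Finset.sum_nonneg fun n _ => mul_nonneg (lambdaVec_nonneg ks n) (A.a_nonneg n)

/-- **The three lemmata combined, vector weight** ([FriedlanderIwaniecPisa1978] pp. 739–740,
"Conclusion of proof of Theorem 1", up to the display
`∑_{n ≤ x} a_n Λ_{(k)}(n) = H A(x) F + O(ε^{1/3} A(x)(log x)^{|k|−1})` for `x > x₀(ε, (k))`), for
`(k) = (k', a)` with `a ≥ 2`. With the running parameter `u = ε^{−1/3} → ∞`
(`y = x^{1−2u^{−3}}`, `z = x^{u^{−4}}`, `s = u`): for every `ε' > 0`, for all large `u` and then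
all large `x`, `|S_(k)(x) − H A(x) F(𝔏_(k'), a; x, y, z)| ≤ ε' A(x)(log x)^{|k|−1}`. Ingredients:
the dissection (`sum_lambdaVec_mul_eq_three`); `Σ₀ ≤ 2^{|k|} Σ₀(Λ_{|k|})` (`sigma0Vec_le`) and
the scalar Lemma 10 (`FI1978_lemma10_holds`, with `δ = u^{−4} 2^{−|k|}`); Lemma 11
(`lemma11Gen`) and Lemma 12 (`lemma12Gen`) with the coefficient bound
`|𝔏_(k')(d)| ≤ 2^{|k'|}(log x)^{|k'|}` (`abs_lambdaVec_mul_moebius_le_of_le`); (A₄); and the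
arithmetic of the scalar case (`sigma0_arith`, `sigma1_arith`, `sigma2_arith`, `params`).
[cite: FriedlanderIwaniecPisa1978, pp. 739-740 (conclusion of proof of Theorem 1)] -/
theorem coreVec {A : SieveSequence} {H : ℝ} (hA : A.IsBombieriSequence)
    (hH : A.HasDensityConstant H) (ks : List ℕ) {a : ℕ} (ha : 2 ≤ a) {ε : ℝ} (hε : 0 < ε) :
    ∀ᶠ u : ℝ in atTop, ∀ᶠ x : ℝ in atTop,
      |(∑ n ∈ Ioc 0 ⌊x⌋₊, ((ks ++ [a]).map generalizedVonMangoldt).prod n * A.a n) -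
          H * A.size x *
            ((∏ p ∈ Nat.primesBelow ⌈x ^ (u⁻¹ ^ 4)⌉₊, (1 - (p : ℝ)⁻¹)) *
              ∑ d ∈ (Ico 1 ⌈x ^ (1 - 2 * u⁻¹ ^ 3)⌉₊).filter
                  (fun d : ℕ => d.Coprime (primesProdBelow (x ^ (u⁻¹ ^ 4)))),
                ((ks.map generalizedVonMangoldt).prod * (μ : ArithmeticFunction ℝ)) d / d *
                  Real.log (x / d) ^ a)| ≤
        ε * A.size x * Real.log x ^ (ks.sum + a - 1) := by
  obtain ⟨m, rfl⟩ : ∃ m, a = m + 2 := ⟨a - 2, by omega⟩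
  set r := ks.sum with hr
  have e1 : r + (m + 2) - 1 = r + m + 1 := by omega
  have eK : (ks ++ [m + 2]).sum = r + m + 2 := by
    rw [List.sum_append, List.sum_singleton, hr]; omega
  -- the three lemmata (scalar Lemma 10 at `K = |k|`, general Lemmata 11, 12 at `a`)
  obtain ⟨C₀, hC₀⟩ := FI1978_lemma10_holds A hA (r + m + 2) (by omega)
  obtain ⟨C₂, hC₂⟩ := lemma11Gen A hA (m + 2)
  obtain ⟨η, hη, C₁, hC₁⟩ := lemma12Gen A H hA hH (a := m + 2) (by omega)
  have e2 : r + m + 2 - 2 = r + m := by omega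
  have e3 : r + m + 2 - 1 = r + m + 1 := by omega
  have e4 : m + 2 - 1 = m + 1 := by omega
  have e5 : m + 2 - 2 = m := by omega
  simp only [e2, e3] at hC₀
  simp only [e4, e5] at hC₁
  rw [e1]
  -- the constants after absorbing `2^{|k'|}` (coefficient bound) and `2^{|k|}` (domination)
  set D₀ := max (2 ^ (r + m + 2) * C₀) 0 with hD₀
  set D₁ := max (C₁ * 2 ^ r) 0 with hD₁
  set D₂ := max (C₂ * 2 ^ r) 0 with hD₂
  -- the function `Ψ(u)` bounding `|S − HAF| / (A L^{|k|−1})` tends to `0`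
  have hΨ : Tendsto (fun u : ℝ => (D₀ + 1 + 2 * D₁) * u⁻¹ ^ 4 + D₂ * 2 ^ (m + 3) * u⁻¹ +
      D₁ * (u ^ 8 * Real.exp (-u))) atTop (𝓝 0) := by
    have h1 : Tendsto (fun u : ℝ => u⁻¹) atTop (𝓝 0) := tendsto_inv_atTop_zero
    have h2 : Tendsto (fun u : ℝ => u⁻¹ ^ 4) atTop (𝓝 0) := by simpa using h1.pow 4
    have h3 := Real.tendsto_pow_mul_exp_neg_atTop_nhds_zero 8
    simpa using ((h2.const_mul (D₀ + 1 + 2 * D₁)).add (h1.const_mul (D₂ * 2 ^ (m + 3)))).add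
      (h3.const_mul D₁)
  filter_upwards [(tendsto_order.1 hΨ).2 ε hε, eventually_ge_atTop (2 : ℝ)] with u hu hu2
  -- from now on `u ≥ 2` is fixed; `v = u⁻¹ ≤ 1/2`
  have hu0 : 0 < u := by linarith
  set v : ℝ := u⁻¹ with hv
  have hv0 : 0 < v := inv_pos.mpr hu0
  have hv1 : v ≤ 1 / 2 := by rw [hv, one_div]; exact (inv_le_inv₀ hu0 two_pos).mpr hu2
  have hvu : v * u = 1 := by rw [hv]; exact inv_mul_cancel₀ hu0.ne'
  -- the three lemmata at this `u`
  have h10' := hC₀ (v ^ 4 / 2 ^ (r + m + 2)) (by positivity)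
  have h11' := hC₂ (v ^ 3) (by positivity)
  have h12' := hC₁ (v ^ 3) (by positivity) u hu2
  -- (A₄): `∫₁^x A(t) dt/t ≤ v¹² A(x) log x` eventually
  have hI : ∀ᶠ x : ℝ in atTop,
      ∫ t in (1 : ℝ)..x, A.size t / t ≤ v ^ 12 * (A.size x * Real.log x) := by
    filter_upwards [hA.2.2.2.2.1.1.bound (by positivity : 0 < v ^ 12),
      eventually_ge_atTop (1 : ℝ)] with x hx hx1
    have hA0 : 0 ≤ A.size x := SieveSequence.size_nonneg_of_size_eq hA.size_eq x
    rw [Real.norm_of_nonneg (mul_nonneg hA0 (Real.log_nonneg hx1))] at hx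
    exact (le_abs_self _).trans hx
  -- `z^{−η} log x = x^{−η v⁴} log x ≤ v¹²` eventually
  have hzeta : ∀ᶠ x : ℝ in atTop, x ^ (-(η * v ^ 4)) * Real.log x ≤ v ^ 12 := by
    have hlo :=
      (isLittleO_log_rpow_rpow_atTop 1 (by positivity : 0 < η * v ^ 4)).tendsto_div_nhds_zero
    filter_upwards [(tendsto_order.1 hlo).2 _ (by positivity : 0 < v ^ 12),
      eventually_gt_atTop (0 : ℝ)] with x hx hx0
    rw [Real.rpow_one] at hx
    rw [Real.rpow_neg hx0.le, inv_mul_eq_div]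
    exact hx.le
  have hz2 : ∀ᶠ x : ℝ in atTop, 2 ≤ x ^ (v ^ 4) :=
    (tendsto_rpow_atTop (by positivity : 0 < v ^ 4)).eventually_ge_atTop 2
  filter_upwards [h10', h11', h12', hI, hzeta, hz2, eventually_ge_atTop (3 : ℝ)]
    with x h10x h11x h12x hIx hzx hz2x hx3
  -- notation and elementary facts at this `x`
  have hx2 : 2 ≤ x := by linarith
  have hx0 : 0 < x := by linarith
  have hx1 : 1 < x := by linarith
  obtain ⟨hz14, hzy, hzsy, hyx, hy1, hzsy'⟩ := params hv0 hv1 hvu hx2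
  set L := Real.log x with hL
  set S := A.size x with hS
  set y := x ^ (1 - 2 * v ^ 3) with hy
  set z := x ^ (v ^ 4) with hz
  have hL1 : 1 ≤ L :=
    LFunctions.MertensBound.one_lt_log_three.le.trans (Real.log_le_log (by norm_num) hx3)
  have hL0 : 0 < L := by linarith
  have hS0 : 0 ≤ S := SieveSequence.size_nonneg_of_size_eq hA.size_eq x
  have hy0 : 0 < y := Real.rpow_pos_of_pos hx0 _
  have hlogz : Real.log z = v ^ 4 * L := Real.log_rpow hx0 _
  have hlogxy : Real.log (x / y) = 2 * v ^ 3 * L := by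
    rw [Real.log_div hx0.ne' hy0.ne', hy, Real.log_rpow hx0]; ring
  -- the coefficient `𝔏 = Λ_(k') ∗ μ` and its bound `M = 2^{|k'|} L^{|k'|}`
  set lam : ℕ → ℝ := fun d =>
    ((ks.map generalizedVonMangoldt).prod * (μ : ArithmeticFunction ℝ)) d with hlam
  set M : ℝ := 2 ^ r * L ^ r with hM
  have hM0 : 0 ≤ M := by positivity
  have hlamM : ∀ d : ℕ, 1 ≤ d → (d : ℝ) ≤ x → |lam d| ≤ M := fun d hd hdx =>
    abs_lambdaVec_mul_moebius_le_of_le ks hd hdx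
  have hW0 : 0 ≤ S * L ^ (r + m + 1) := by positivity
  -- Lemma 10 via domination: Σ₀ ≤ (D₀ + 1) v⁴ · S L^{r+m+1}
  have B0 : ∑ n ∈ (Ioc 0 ⌊x⌋₊).filter (fun n : ℕ => ¬ n.Coprime (primesProdBelow z)),
      ((ks ++ [m + 2]).map generalizedVonMangoldt).prod n * A.a n ≤
      (D₀ + 1) * v ^ 4 * (S * L ^ (r + m + 1)) := by
    have h := h10x z hz2x hz14
    rw [hlogz] at h
    have hdom := sigma0Vec_le A (ks ++ [m + 2]) x z
    rw [eK] at hdom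
    have h2K : (0 : ℝ) < 2 ^ (r + m + 2) := by positivity
    have h' : 2 ^ (r + m + 2) * sigma0 A (r + m + 2) x z ≤
        (2 ^ (r + m + 2) * C₀) * S * L ^ (r + m) * (v ^ 4 * L) +
          v ^ 4 * S * L ^ (r + m + 1) := by
      calc 2 ^ (r + m + 2) * sigma0 A (r + m + 2) x z
          ≤ 2 ^ (r + m + 2) * (C₀ * S * L ^ (r + m) * (v ^ 4 * L) +
              v ^ 4 / 2 ^ (r + m + 2) * S * L ^ (r + m + 1)) :=
            mul_le_mul_of_nonneg_left h h2K.le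
        _ = (2 ^ (r + m + 2) * C₀) * S * L ^ (r + m) * (v ^ 4 * L) +
              v ^ 4 * S * L ^ (r + m + 1) := by field_simp
    exact sigma0_arith hS0 hL0.le (hdom.trans h')
  -- Lemma 11: |Σ₂| ≤ D₂ 2^{m+3} v · S L^{r+m+1}
  have B2 : |∑ n ∈ (Ioc 0 ⌊x⌋₊).filter (fun n : ℕ => n.Coprime (primesProdBelow z)),
      (∑ e ∈ n.divisorsAntidiagonal with y ≤ ((e.1 : ℕ) : ℝ), lam e.1 * Real.log e.2 ^ (m + 2)) *
        A.a n| ≤ D₂ * 2 ^ (m + 3) * v * (S * L ^ (r + m + 1)) := by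
    have h := h11x y z M lam hM0 hlamM hz2x hzy hzsy hyx
    rw [hlogxy, hlogz, hM] at h
    have hSL : 0 ≤ L ^ r * S := by positivity
    have h' : |∑ n ∈ (Ioc 0 ⌊x⌋₊).filter (fun n : ℕ => n.Coprime (primesProdBelow z)),
        (∑ e ∈ n.divisorsAntidiagonal with y ≤ ((e.1 : ℕ) : ℝ),
          lam e.1 * Real.log e.2 ^ (m + 2)) * A.a n| ≤
        (C₂ * 2 ^ r) * (L ^ r * S) * (2 * v ^ 3 * L) ^ (m + 2 + 1) / (v ^ 4 * L) ^ 2 := by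
      refine h.trans (le_of_eq ?_); ring
    have h'' := sigma2_arith hSL hL0 hv0 (by linarith) h'
    calc _ ≤ max (C₂ * 2 ^ r) 0 * 2 ^ (m + 3) * v * (L ^ r * S * L ^ (m + 1)) := h''
      _ = D₂ * 2 ^ (m + 3) * v * (S * L ^ (r + m + 1)) := by rw [hD₂]; ring
  -- Lemma 12: |Σ₁ − HSF| ≤ D₁ (u⁸ e^{−u} + 2 v⁴) · S L^{r+m+1}
  have B1 : |(∑ n ∈ (Ioc 0 ⌊x⌋₊).filter (fun n : ℕ => n.Coprime (primesProdBelow z)),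
      (∑ e ∈ n.divisorsAntidiagonal with ((e.1 : ℕ) : ℝ) < y,
        lam e.1 * Real.log e.2 ^ (m + 2)) * A.a n) -
        H * S * ((∏ p ∈ Nat.primesBelow ⌈z⌉₊, (1 - (p : ℝ)⁻¹)) *
          ∑ d ∈ (Ico 1 ⌈y⌉₊).filter (fun d : ℕ => d.Coprime (primesProdBelow z)),
            lam d / d * Real.log (x / d) ^ (m + 2))| ≤
      D₁ * (u ^ 8 * Real.exp (-u) + 2 * v ^ 4) * (S * L ^ (r + m + 1)) := by
    have h := h12x y z M lam hM0 hlamM hz2x hy1 hzsy'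
    have hratio : L / Real.log z = u ^ 4 := by
      rw [hlogz, div_eq_iff (by positivity)]
      have : v ^ 4 * u ^ 4 = 1 := by rw [← mul_pow, hvu, one_pow]
      calc L = L * (v ^ 4 * u ^ 4) := by rw [this, mul_one]
        _ = u ^ 4 * (v ^ 4 * L) := by ring
    have hzη : z ^ (-η) = x ^ (-(η * v ^ 4)) := by
      rw [hz, ← Real.rpow_mul hx0.le]; ring_nf
    rw [hratio, hzη, hM] at h
    have hint0 : 0 ≤ ∫ t in (1 : ℝ)..x, A.size t / t :=
      intervalIntegral.integral_nonneg hx1.le fun t ht =>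
        div_nonneg (SieveSequence.size_nonneg_of_size_eq hA.size_eq t) (by linarith [ht.1])
    have hSL : 0 ≤ L ^ r * S := by positivity
    -- rewrite the error in the scalar shape with `S' = L^r S`, `I' = L^r ∫`
    have h' : |(∑ n ∈ (Ioc 0 ⌊x⌋₊).filter (fun n : ℕ => n.Coprime (primesProdBelow z)),
        (∑ e ∈ n.divisorsAntidiagonal with ((e.1 : ℕ) : ℝ) < y,
          lam e.1 * Real.log e.2 ^ (m + 2)) * A.a n) -
          H * S * ((∏ p ∈ Nat.primesBelow ⌈z⌉₊, (1 - (p : ℝ)⁻¹)) *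
            ∑ d ∈ (Ico 1 ⌈y⌉₊).filter (fun d : ℕ => d.Coprime (primesProdBelow z)),
              lam d / d * Real.log (x / d) ^ (m + 2))| ≤
        (C₁ * 2 ^ r) * (Real.exp (-u) * (L ^ r * S) * L ^ (m + 1) +
          (L ^ r * ∫ t in (1 : ℝ)..x, A.size t / t) * L ^ m +
          x ^ (-(η * v ^ 4)) * (L ^ r * S) * L ^ (m + 2)) * (u ^ 4) ^ 2 := by
      refine h.trans (le_of_eq ?_); ring
    have hI' : L ^ r * ∫ t in (1 : ℝ)..x, A.size t / t ≤ v ^ 12 * (L ^ r * S * L) := by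
      calc L ^ r * ∫ t in (1 : ℝ)..x, A.size t / t ≤ L ^ r * (v ^ 12 * (S * L)) :=
            mul_le_mul_of_nonneg_left hIx (by positivity)
        _ = v ^ 12 * (L ^ r * S * L) := by ring
    have h'' := sigma1_arith hSL hL0.le (Real.exp_pos _).le (by positivity)
      (Real.rpow_nonneg hx0.le _) hvu hI' hzx h'
    calc _ ≤ max (C₁ * 2 ^ r) 0 * (u ^ 8 * Real.exp (-u) + 2 * v ^ 4) *
          (L ^ r * S * L ^ (m + 1)) := h''
      _ = D₁ * (u ^ 8 * Real.exp (-u) + 2 * v ^ 4) * (S * L ^ (r + m + 1)) := by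
          rw [hD₁]; ring
  -- combine
  have hsplit := sum_lambdaVec_mul_eq_three A ks (by omega : 0 < m + 2) x y z
  have h0abs : |∑ n ∈ (Ioc 0 ⌊x⌋₊).filter (fun n : ℕ => ¬ n.Coprime (primesProdBelow z)),
      ((ks ++ [m + 2]).map generalizedVonMangoldt).prod n * A.a n| =
      ∑ n ∈ (Ioc 0 ⌊x⌋₊).filter (fun n : ℕ => ¬ n.Coprime (primesProdBelow z)),
        ((ks ++ [m + 2]).map generalizedVonMangoldt).prod n * A.a n :=
    abs_of_nonneg (sigma0Vec_nonneg A _ x z)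
  rw [hsplit]
  calc _ ≤ |∑ n ∈ (Ioc 0 ⌊x⌋₊).filter (fun n : ℕ => ¬ n.Coprime (primesProdBelow z)),
          ((ks ++ [m + 2]).map generalizedVonMangoldt).prod n * A.a n| +
        |(∑ n ∈ (Ioc 0 ⌊x⌋₊).filter (fun n : ℕ => n.Coprime (primesProdBelow z)),
          (∑ e ∈ n.divisorsAntidiagonal with ((e.1 : ℕ) : ℝ) < y,
            lam e.1 * Real.log e.2 ^ (m + 2)) * A.a n) -
          H * S * ((∏ p ∈ Nat.primesBelow ⌈z⌉₊, (1 - (p : ℝ)⁻¹)) *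
            ∑ d ∈ (Ico 1 ⌈y⌉₊).filter (fun d : ℕ => d.Coprime (primesProdBelow z)),
              lam d / d * Real.log (x / d) ^ (m + 2))| +
        |∑ n ∈ (Ioc 0 ⌊x⌋₊).filter (fun n : ℕ => n.Coprime (primesProdBelow z)),
          (∑ e ∈ n.divisorsAntidiagonal with y ≤ ((e.1 : ℕ) : ℝ),
            lam e.1 * Real.log e.2 ^ (m + 2)) * A.a n| := by
        refine le_trans (le_of_eq ?_) (abs_add_three _ _ _)
        congr 1
        ring
    _ ≤ (D₀ + 1) * v ^ 4 * (S * L ^ (r + m + 1)) +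
          D₁ * (u ^ 8 * Real.exp (-u) + 2 * v ^ 4) * (S * L ^ (r + m + 1)) +
          D₂ * 2 ^ (m + 3) * v * (S * L ^ (r + m + 1)) := by rw [h0abs]; linarith
    _ = ((D₀ + 1 + 2 * D₁) * v ^ 4 + D₂ * 2 ^ (m + 3) * v + D₁ * (u ^ 8 * Real.exp (-u))) *
          (S * L ^ (r + m + 1)) := by ring
    _ ≤ ε * (S * L ^ (r + m + 1)) := mul_le_mul_of_nonneg_right hu.le hW0
    _ = ε * S * L ^ (r + m + 1) := by ring

end BombieriSieve

end Literature.NumberTheory.Sieve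

end
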